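import Literature.MathematicalPhysics.QuantumFieldTheory.Dimock2011to13.ActiveBoundaryTerms
import Literature.MathematicalPhysics.QuantumFieldTheory.Dimock2011to13.ResummationOperation
import Literature.MathematicalPhysics.QuantumFieldTheory.Dimock2011to13.Reblocking
import Literature.MathematicalPhysics.QuantumFieldTheory.Dimock2011to13.ConnectedPolymerSums
import Literature.MathematicalPhysics.QuantumFieldTheory.Dimock2011to13.SeparatedCubesTreeLength

/-!
# Dimock, *The renormalization group according to Balaban* II, §3.13 LEMMA 3.15 (`\label{first}`), steps (E), (G),
# (H) and the printed bound (boundary) ON THE CELL'S TORUS: `Z ↦ Z⁺` CONCRETE (`ResummationOperation.adjoin`),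
# `d_{LM}(·, mod Ω^c_{k+1})` = `ThreeSorted.torusTreeLenMod`, every side condition of `ActiveBoundaryTerms` DISCHARGED
# from the (snuffit) shape — (siouZ), (drum1), (drum2), (G), (city) PROVED on one carrier

**Citation header (reproduction of PUBLISHED work; template of the Bałaban lattice Yang–Mills cell).**
J. Dimock, *The renormalization group according to Balaban II. Large fields*, J. Math. Phys. **54** (2013) 092301
(= arXiv:1212.5562v2) [Dimock2013BalabanII], §3.13 `\subsection{localization}` (TeX L4445): LEMMA 3.15 `\label{first}`
L4456–4482 with (city) L4458–4466 and (boundary) L4477–4480, Remarks L4486–4497, proof (A)–(H) L4499–4777: (E) with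
(foreign) L4651–4662, (F) = (stovepipe)∕(snuffit) L4665–4722, **(G) L4724–4736**, **(H) L4739–4777** ((siouZ) L4757–4759,
(drum1) L4764–4769, (drum2) L4770–4776).  TeX line numbers refer to the arXiv source held by the cell
(`inputs/files/dimock/src/1212.5562/1212.5562.tex`, 7217 lines, sha256[:16] 75c5792fc48eacbc); every quotation below was
read there this session.  Dimock's papers are published and refereed and are the cell's TEMPLATE, not manuscripts under
audit; no quantity of the Bałaban series is touched.

**What the paper prints (verbatim, TeX → Unicode; `…` marks an elision).**  LEMMA 3.15 (L4456–4481): *"For (Φ_{k,δΩ_k},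
Φ_{k+1,Ω_{k+1}}) in (sandy) …, and |W_k| ≤ B_w p_k:  δE^+_k(Λ_k, φ⁰_{k+1,𝛀′}, 𝒲_{k,𝛀′}) = Σ_{Y∈𝒟⁰_{k+1}: Y⊂Λ_{k+1}}
(δE^+_k)^{loc}(Y, φ⁰_{k+1,𝛀′}, W_k) + Σ_{Y∈𝒟⁰_{k+1}(mod Ω^c_{k+1}), Y#Λ_{k+1}} B^{(E)}_{k,𝚷⁺}(Y) + B̃_{k+1,𝚷⁺} terms"*
(city) *"… 2. For Y ∈ 𝒟⁰_{k+1}(mod Ω^c_{k+1}) the boundary term B^{(E)}_{k,𝚷⁺}(Y, …) depends on the fields only in Y. It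
is analytic the stated domain and satisfies there |B^{(E)}_{k,𝚷⁺}(Y)| ≤ 𝒪(1)L³λ_k^{1/4−10ε}e^{−L(κ−2κ_0−3)d_{LM}(Y, mod
Ω^c_{k+1})}"* (boundary).  Remark 1 (L4487–4490): *"The expression “B̃_{k+1,𝚷⁺} terms” will be used repeatedly. It refers
to functions localized in Λ^c_{k+1} which are bounded by C|Λ^{(k)}_k − Λ^{(k)}_{k+1}| = C Vol(Λ_k − Λ_{k+1}). Local
structure is no longer important for these terms."*  (E) (L4651–4662): *"… (δE^+_k)^{(iv)}(Z) = Σ_{Y_2: Ȳ_2=Z}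
(δE^+_k)‴(Y_2) … The function (δE^+_k)^{(iv)}(Z) vanishes unless Z ∩ Λ^c_{k+1} ≠ ∅, Z ∩ Λ_k ≠ ∅ so we can write our
expression as Σ_{Z∈𝒟⁰_{k+1}, Z∩Λ^c_{k+1}≠∅, Z∩Λ_k≠∅} (δE^+_k)^{(iv)}(Z)"* (foreign).  (G) (L4724–4736): *"Terms in (foreign)
with Z ⊂ Λ^c_{k+1} are the B̃_{k+1,𝚷⁺} terms in (city). These are estimated by 𝒪(1)L³λ_k^{1/4−10ε} Σ_{Z: Z⊂Λ^c_{k+1},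
Z∩Λ_k≠∅} e^{−L(κ−κ_0−2)d_{LM}(Z)} ≤ 𝒪(1)L³λ_k^{1/4−10ε} Σ_{□⊂Λ̄_k−Λ_{k+1}} Σ_{Z⊃□} e^{−L(κ−κ_0−2)d_{LM}(Z)} ≤
𝒪(1)L³λ_k^{1/4−10ε}|Λ̄_k − Λ_{k+1}|_{LM}  where the sum is over LM cubes □."*  (H) (L4739–4777): *"The remaining terms in
(foreign) satisfy Z # Λ_{k+1} and yield the active boundary terms B^{(E)}_{k,𝚷⁺} terms in (city). First note that each such
Z determines a Z⁺ ∈ 𝒟⁰_{k+1}(mod Ω^c_{k+1}) by taking the union with all connected components of Ω_{k+1}^c connected to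
Z, written Z → Z⁺. We define B^{(E)}_{k,𝚷⁺}(Y) = Σ_{Z#Λ_{k+1}, Z⁺=Y} (δE^+_k)^{(iv)}(Z) Then we have Σ_{Z#Λ_{k+1}}
(δE^+_k)^{(iv)}(Z) = Σ_{Y∈𝒟⁰_{k+1}(mod Ω^c_{k+1}), Y#Λ_{k+1}} B^{(E)}_{k,𝚷⁺}(Y)  To estimate B^{(E)}_{k,𝚷⁺}(Y) first note
that d_{LM}(Z) ≥ d_{LM}(Z⁺, mod Ω_{k+1}^c)* (siouZ) *Indeed let τ be a minimal tree joining the cubes in Z of length ℓ(τ) =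
LMd_{LM}(Z). Then τ is also a tree joining the cubes in Z⁺ ∩ Ω_{k+1} since Z⁺ ∩ Ω_{k+1} = Z ∩ Ω_{k+1} ⊂ Z. Hence ℓ(τ) ≥
LMd_{LM}(Z⁺, mod Ω_{k+1}^c) and hence the result. Using this and (snuffit) gives |B^{(E)}_{k,𝚷⁺}(Y)| ≤
𝒪(1)L³λ_k^{1/4−10ε}e^{−(L(κ−κ_0−2)−κ_0)d_{LM}(Y, mod Ω_{k+1}^c)} Σ_{Z⊂Y, Z#Λ_{k+1}} e^{−κ_0 d_{LM}(Z)}* (drum1) *But the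
sum is bounded by 𝒪(1)|Y ∩ Λ_{k+1}|_{LM} ≤ |Y ∩ Ω_{k+1}|_{LM} ≤ 𝒪(1)(d_{LM}(Y ∩ Ω_{k+1}) + 1) = 𝒪(1)(d_{LM}(Y, mod
Ω_{k+1}^c) + 1) ≤ 𝒪(1)e^{d_{LM}(Y, mod Ω_{k+1}^c)}* (drum2) *The coefficient of d_{LM}(Y ∩ Ω_{k+1}) is then
L(κ−κ_0−2)−κ_0−1 ≥ L(κ−2κ_0−3) and we have the result."*

**Why this module.**  TEMPLATE.md §4.2 row «D2 §3.13 localization Lemmas 3.15–3.17» holds (gen 35) `ActiveBoundaryTerms`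
— (E)–(H) as finite-sum bookkeeping for an ABSTRACT completion map `cpl = (Z ↦ Z⁺)` with the two printed properties
as hypotheses, ONE abstract length `dl` monotone on non-empty subsets, `d(Y, mod Ω^c) := dl(Y ∩ Ω)` (its reading (ii)),
and its §6 discharged on the INFINITE lattice `Pt d` with the Steiner length — and (gen 40) `LocalizationSumDecay`, which
PROVES (snuffit) on the cell's TORUS `TPt d n` with unit pv22's `torusTreeLen` (= `d_{LM}` on connected families; junk on
disconnected ones, so `ActiveBoundaryTerms` §3–§4 cannot consume it: `torusTreeLen` is not monotone on arbitrary
subsets and `Y ∩ Ω_{k+1}` is in general disconnected).  The object that closes the gap already exists in the lineage: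
`ThreeSorted.coverLen S B` ∕ `torusTreeLenMod X Θ` (gen 15, `ThreeSortedResummation`: graphs in `π⁻¹(X)` meeting every
cube of `X ∖ Θ` = [Dimock2013BalabanII] §3.3 `d_M(X, mod Ω^c)` VERBATIM, meaningful for disconnected `X ∖ Θ`), with the map
`Z ↦ Z⁺` CONCRETE as `ResummationOperation.adjoin Θ Z` (gen 30: `Z` together with every wall-component of `Θ` it meets;
`adjoin_sdiff` = *"Z⁺ ∩ Ω_{k+1} = Z ∩ Ω_{k+1}"*, `dMod_adjoin` = *"Z⁺ ∈ 𝒟⁰_{k+1}(mod Ω^c_{k+1})"*).  This module is the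
junction: LEMMA 3.15's steps (E), (G), (H) and its printed bound (boundary) on ONE carrier — the torus of `LM`-cubes —
from the (snuffit) shape, every side condition discharged.

**What is reproduced here (kernel-checked, zero `sorry`).**  Carrier: the torus `TPt d n` of `LM`-cubes (every `d`,
every `n ≥ 1`), polymers `𝒟⁰_{k+1}` = `Reblocking.doms d n` (non-empty torus-face-connected families), `Θ` = the family of
`LM`-cubes of `Ω^c_{k+1}`, `Λ` = the cubes of `Λ_{k+1}` (`Disjoint Λ Θ`, i.e. `Λ_{k+1} ⊆ Ω_{k+1}`), `κ₀ = κ₀(4·2^d, 2d)`,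
`K₀ = K₀(4·2^d, 2d)` of `B12TreeDecay` (the constants of (sudsy) on the torus, `Reblocking.sum_domsAt_exp_le`).
* Part 1 — **`Z⁺` and (siouZ)**: `adjoin_mem_doms` (Z⁺ is a polymer), `crosses_adjoin` (Z # Λ ⟹ Z⁺ # Λ), `adjoin_image`
  (every `Y = Z⁺` is a polymer in `𝒟⁰_{k+1}(mod Ω^c_{k+1})` crossing `Λ_{k+1}` — the index set of (city)), **`siouZ`**:
  `d_{LM}(Z⁺, mod Θ) ≤ d_{LM}(Z)` for polymers `Z` (= `ResummationOperation.torusTreeLenMod_adjoin_le` at `Θ₀ = ∅`: an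
  admissible graph for `Z` lies in `π⁻¹(Z⁺)` and meets every cube of `Z⁺ ∖ Θ = Z ∖ Θ`).
* Part 2 — **(drum1)** `abs_bterm_adjoin_le`: `|f Z| ≤ c·e^{−(a+κ)d(Z)}` on `P ⊆ 𝒟⁰_{k+1}`, `a ≥ 0` ⟹ `|B^{(E)}(Y)| ≤
  c·e^{−a·d(Y, mod Θ)}·Σ_{Z∈P, Z#Λ, Z⊆Y} e^{−κ d(Z)}` for EVERY `Y`, with `B^{(E)} = ActiveBoundaryTerms.bterm P f Λ (adjoin Θ)`
  (`bterm_eq_Bprime`: the same finite sum as `ResummationOperation.Bprime`).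
* Part 3 — **(drum2)** `sum_filter_mem_exp_le` (the one-cube bound `Σ_{Z∈P, Z∋□} e^{−κd(Z)} ≤ K₀` for `κ ≥ κ₀`, by
  `Reblocking.sum_domsAt_exp_le`), `sum_crosses_subset_exp_le` (`Σ_{Z∈P, Z#Λ, Z⊆Y} e^{−κd(Z)} ≤ K₀|Y ∩ Λ|`),
  `card_inter_le_exp` (`|Z⁺ ∩ Λ| ≤ |Z⁺ ∖ Θ| ≤ 2^{d+2}e^{d(Z⁺, mod Θ)}` by `ResummationOperation.card_sdiff_le_exp`).
* Part 4 — **(boundary) ASSEMBLED**: **`boundary`**: `|B^{(E)}(Y)| ≤ c·K₀·2^{d+2}·e^{−(a−1)·d(Y, mod Θ)}` for every `Y`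
  (empty fibres give `0`), and **`boundary_printed`**: from the (snuffit) shape `|f Z| ≤ c·e^{−L(κ−κ₀−2)d_{LM}(Z)}` with
  `L ≥ 1` and `κ₀ ≤ L(κ−κ₀−2)`: `|B^{(E)}(Y)| ≤ c·K₀·2^{d+2}·e^{−L(κ−2κ₀−3)·d_{LM}(Y, mod Ω^c_{k+1})}` — the printed rate
  of (boundary), *"L(κ−κ_0−2)−κ_0−1 ≥ L(κ−2κ_0−3)"* being `(L−1)(κ₀+1) ≥ 0`.
* Part 5 — **(G)** `abs_sum_disjoint_le_meets`: for polymers `Z ∈ P` each MEETING a family `S` (print: `Z ∩ Λ_k ≠ ∅`,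
  `S = Λ̄_k`), `|Σ_{Z∈P, Z∩Λ=∅} f Z| ≤ c·K₀·|S − Λ|` — *"bounded by C|Λ_k − Λ_{k+1}|"*, the `B̃` shape; the index
  condition is the PRINTED one (meeting `Λ̄_k`), weaker than `ActiveBoundaryTerms.abs_sum_disjoint_le`'s `Z ⊆ S`.
* Part 6 — **(E) + (city)**: `sum_eq_sum_filter_of_vanishes` ((foreign): restricting to the `Z` on which `f` does not
  vanish), `city_adjoin` (= `ActiveBoundaryTerms.city` with `cpl = adjoin Θ` on polymers), `sum_filter_subset_eq_zero` and
  `foreign_split` (on the (foreign) family no `Z ⊆ Λ_{k+1}` occurs, so `Σ_Z f Z = Σ_Y B^{(E)}(Y) + Σ_{Z⊂Λ^c_{k+1}} f Z`).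
* Part 7 — **LEMMA 3.15's (E)(G)(H) IN ONE STATEMENT** `first_EGH` (decomposition + the two bounds + the certification
  of the index set), and a closing non-vacuity `example` (all hypotheses jointly inhabited on every torus).
* Part 8 (v1.1) — **COARSENING OF `coverLen` AND LEMMA 3.17's EXTRACTION INEQUALITY**: `tCover_scale` (port of unit pv22's
  `TreeLengthTorusTransfer.tAdmissible_scale` to target families: the image under `p ↦ p/L` of a graph in `π⁻¹(S)` meeting
  `B`, fine torus `TPt d (L·N′)`, is a graph in `π⁻¹(S̄)` meeting `B̄` on the coarse torus `TPt d N′`, `X̄ = X.image tcoarse`),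
  `mul_coverLen_image_le` (`L·coverLen S̄ B̄ ≤ coverLen S B`), **`mul_torusTreeLenMod_image_le`** (*"d_M(X, mod Ω_k^c) ≥
  L d_{LM}(Y, mod Ω_{k+1}^c)"* for `X̄ = Y`, TeX L5281–5286: `L·d_{LM}(X̄, mod Θ) ≤ d_M(X, mod Θk)` whenever every old hole
  cube lies in a new hole block, i.e. `Ω_{k+1} ⊆ Ω_k`).
* Part 9 (v1.1) — **LEMMA 20 OF PART I FOR TARGET FAMILIES** (*"See lemma 20 in part I for more details"* L5299–5300): `tCover_adjoin_step`
  (one wall-adjacent cube of the ambient family joins the target at cost `≤ 1`; port of pv22's `tadjoin_step`),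
  `exists_tfrontier_of_tLinked`, `exists_tCover_extend`, **`coverLen_le_card_sdiff_add`** (`coverLen S B′ ≤ |B′ ∖ B| + coverLen S B`
  for `B ⊆ B′ ⊆ S` with every cube of `B′` linked inside `B′` to `B`), `exists_tCover_of_linked`.
* Part 10 (v1.1) — **(shonuff)** (TeX L5290–5310): **`shonuff`**: for a polymer `Y`, a family `A ⊇ Y ∖ Θ` (= `Ȳ₁ ⊇ Y ∩ Ω_{k+1}`)
  every cube of which is linked inside `A` to a cube of `Y ∖ Θ` (*"each connected component of Y_1 contains at least one connected
  component of Y"*) and `Z = (Y ∪ A)⁺`: `d_{LM}(Z, mod Θ) ≤ |A ∖ (Y ∖ Θ)| + d_{LM}(Y, mod Θ)`.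
* Part 11 (v1.2) — **LEMMA 3.17 (`third`)'S SUMMATION ASSEMBLED** (TeX L5256–5340) on the two tori (fine `TPt d (L·N′)` of
  `M`-cubes with the old holes `Θk` = `Ω_k^c`, coarse `TPt d N′` of `LM`-cubes with the new holes `Θ` = `Ω_{k+1}^c`, `Ω_{k+1} ⊆ Ω_k`
  blockwise): `P1` (the anchored `Y₁ ⊇ Y ∖ Θ`, `ConnectedPolymerSums.TAnchored`), `union_mem_doms`∕`adjoin_union_mem_doms` (`Z₀ = Y
  ∪ Ȳ₁ ∈ 𝒟⁰_{k+1}`, `Z = Z₀⁺`), **`tSum`** (the collected majorant of `(B_{k,𝚷⁺})″(Z)`, L5271–5279), **`third_term`** (the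
  extraction: `e^{−(κ₁−1)m}e^{−κ d_M(X, mod Θk)} ≤ e^{−L(κ−κ₀)d_{LM}(Z, mod Θ)}·(e^{−½κ₁m}e^{−κ₀d_M(X, mod Θk)})`, `m = |Ȳ₁ ∖ (Y ∖ Θ)|`),
  `sum_P1_le` (LEMMA D.2 = `ConnectedPolymerSums.donut2_torus`), `donut_factor_mod_le` (constants suppressed), `sum_X_le` ((snow) =
  `HoleSummability.sum_exp_torusTreeLenMod_le`), `sum_sum_fibre_eq`, **`third_sum`** (`tSum Z ≤ e^{1/4}2^{d+2}L^dK₁(d)·e^{−(L(κ−κ₀)−2)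
  d_{LM}(Z, mod Θ)}` for every `Z`), **`third_sum_printed`** (`L ≥ 1`: the printed rate `L(κ−κ₀−2)`), `tiny_factor` (the arithmetic
  of L5362–5365), and a non-vacuity `example` for the three «M sufficiently large» clauses.
* Part 12 (v1.3) — **LEMMA 3.17's `B̃` TERMS AND THE TINY FACTOR** (TeX L5346–5372): `sum_filter_mem_exp_mod_le` (the one-cube
  bound MODULO HOLES = (snow) on the coarse torus), **`abs_sum_disjoint_le_meets_mod`** (*"terms with Z ⊂ Λ^c_{k+1} … ≤ 𝒪(1)|Λ̄_k −
  Λ_{k+1}|_{LM}"*: `|Σ_{Z∩Λ=∅} f Z| ≤ c·K₁(d)·|S ∖ Λ|` for polymers of `𝒟⁰(mod Θ)` meeting a hole-free family `S`), `le_len_of_tCover_far`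
  ∕ `le_coverLen_of_far` ∕ **`le_torusTreeLenMod_of_far`** (*"any tree joining the LM cubes in Z ∩ Ω_{k+1} must have length at least
  r_{k+1}LM … d_{LM}(Z, mod Ω^c_{k+1}) ≥ r_{k+1}"* for two cubes of `Z ∖ Θ` at least `r` layers apart — the graph-level form of
  `SeparatedCubesTreeLength` for TARGET families), **`third_tiny`** (`e^{−L(κ−κ₀−2)d} ≤ e^{−r}·e^{−L(κ−κ₀−3)d}` for `L ≥ 1`, `d ≥ r`).
* Part 13 (v1.3) — **THE §3.13 SUMMARY** (TeX L5378–5431): `decay_rate_mono`, **`abs_Bloc_le`** (`B^{loc} = B^{(E)} + B^{(R)} +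
  B^{(B)}` at the three printed rates ⟹ the common rate `L(κ−3κ₀−3)`), `Hloc` (`H_{k,𝚷⁺}(Y) = ((δE^+_k)^{loc} + R^{loc})(Y)·1_{Y⊂Λ_{k+1}} +
  B^{loc}(Y)·1_{Y#Λ_{k+1}}`), `sum_Hloc_eq` (the split of `Σ_Y H(Y)`), **`abs_Hloc_le`** (*"if Y ⊂ Λ_{k+1} ⊂ Ω_{k+1} then d_{LM}(Y) =
  d_{LM}(Y, mod Ω_{k+1})"* ⟹ `|H(Y)| ≤ (c₁+c₂+c₃)e^{−L(κ−3κ₀−3)d_{LM}(Y, mod Θ)}` from the Summary's three displayed bounds).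

**Readings ∕ divergences (declared).**  (i) CARRIER as in the whole lineage (`Reblocking`, `LocalizationSumDecay`,
`ThreeSortedResummation`, `ResummationOperation`): cubes = points of the torus `(ℤ/n)^d`, wall adjacency `TAdj`, polymers
= non-empty `TFaceConnected` families, `d_{LM}` = `torusTreeLen` (graphs in the universal cover, conventions D-pv22.1 ∕
D-pv22g2.1), `d_{LM}(Y, mod Ω^c)` = `torusTreeLenMod Y Θ` (graphs in `π⁻¹(Y)` meeting the cubes of `Y ∖ Θ`), `𝒟⁰(mod Ω^c)`
= the component-free `DMod Θ`.  (ii) *"connected components of Ω^c_{k+1} connected to Z"* (L4745) is read, as in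
`ResummationOperation` reading (i), as the wall-components of `Θ` MEETING `Z` (`adjoin`) — the least choice making `Z⁺ ∈
𝒟⁰_{k+1}(mod Ω^c_{k+1})`; (drum1)∕(boundary) hold for it with the printed mechanism.  (iii) (drum2)'s middle terms
*"|Y ∩ Ω_{k+1}|_{LM} ≤ 𝒪(1)(d_{LM}(Y ∩ Ω_{k+1}) + 1) = 𝒪(1)(d_{LM}(Y, mod Ω^c_{k+1}) + 1)"* are proved directly as `|Y ∖ Θ| ≤
2^d(4 d_{LM}(Y, mod Θ) + 1) ≤ 2^{d+2}e^{d_{LM}(Y, mod Θ)}` from the graphs defining `d_{LM}(Y, mod Θ)` (no length of the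
possibly disconnected `Y ∩ Ω_{k+1}` is needed; `ResummationOperation` reading (iv)).  (iv) CONSTANTS explicit: `𝒪(1)` of
(drum2) = `K₀(4·2^d, 2d)·2^{d+2}` at threshold `κ₀(4·2^d, 2d)` (the (sudsy) of the torus; print *"κ_0, K_0 = 𝒪(1)"*); the
analytic prefactor `𝒪(1)L³λ_k^{1/4−10ε}` is the user's `c ≥ 0`; the side condition `κ₀ ≤ L(κ−κ₀−2)` (non-negativity of the
extracted rate, implicit in print) is displayed.  (v) (G)'s bound is stated with `|S ∖ Λ|` for any family `S` met by every
`Z ∈ P` (print: `S = Λ̄_k`, the `LM`-cubes meeting `Λ_k`, and *"|Λ̄_k − Λ_{k+1}|_{LM} = M^{−3}|Λ̄^{(k+1)}_k − Λ^{(k+1)}_{k+1}|"*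
L4734–4735 is the user's unit conversion).  (vi) (H) in GENERAL position — old holes `Θ₀ ⊆ Θ`, the one-cube bound by
LEMMA E.3 at threshold `κ₁(d)` — is `ResummationOperation.abs_Bprime_le` ([Dimock2013BalabanIII] App. B LEMMA 19); here
`Θ₀ = ∅` and the one-cube bound is the (sudsy) of connected polymers, as (drum1)–(drum2) print (`Σ_{Z⊂Y, Z#Λ_{k+1}}
e^{−κ_0 d_{LM}(Z)}` over `Z ∈ 𝒟⁰_{k+1}`).  (vii) The same three Parts serve LEMMA 3.16 `second`'s `B^{(R)}` (with (x2) =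
`LocalizationSumDecay.x2_printed` for (snuffit)) — `f` is abstract.  (viii) (v1.2) THE `Y₁`-CARRIER of LEMMA 3.17 is
instantiated on the `LM`-cubes: the print's elementary `𝛀′`-cubes inside `Ω_{k+1}` ARE `LM`-cubes (where `Y ∩ Ω_{k+1}` lives),
and outside them the finer cubes only increase `|Y₁ − (Y ∩ Ω_{k+1})|_{𝛀′} ≥ |Ȳ₁ − (Y ∩ Ω_{k+1})|_{LM}` (L5287–5288), the
direction used — as the instance `snuffit_LM` of `LocalizationSumDecay` Part 3; an abstract middle carrier (finite type with
adjacency of bounded degree and an `LM`-blocking map) would enter only through that count and LEMMA D.2.  (ix) (v1.2) *"we can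
take this factor with a coefficient L by borrowing from the κ_1−1"* (L5289) is used with the coefficient `L(κ−κ₀)` that the
displayed extraction `e^{−L(κ−κ_0)d_{LM}(Z, mod Ω^c_{k+1})}` (L5317) requires — the explicit clause `L(κ−κ₀) ≤ ½κ₁ − 1`, the
same «M sufficiently large» clause as step (F) of LEMMA 3.15 (L4684; `LocalizationSumDecay.stovepipe_term`'s `hM`).  (x) (v1.2)
CONSTANTS of LEMMA 3.17: the (snow) threshold and constant are `HoleSummability.kappa₁ d ≤ κ₀`, `K₁ d` (print: *"universal
constants κ_0, K_0"* L1700), LEMMA D.2 at rate `½κ₁` under `log 2 + 2log(2d+1) ≤ ¼κ₁`, the suppression clause `(2d+1)e^{−¼κ₁}2^{d+2}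
≤ 1`; `𝒪(1)L³` = `e^{1/4}2^{d+2}K₁(d)·L^d`; the analytic prefactor `𝒪(1)B₀λ_k^β` is the user's; the side conditions `X # Λ_k` of
(spitoon)∕(able) ride in the abstract family `𝒳` (only `X ∈ 𝒟_k(mod Θk)` and `X ∩ Ω_{k+1} ≠ ∅` are used, as in print).

**What is NOT claimed.**  Steps (A)–(D) and (F) of the proof (analyticity, Cauchy bounds, the decoupling and random-walk
expansions; (snuffit) itself is `LocalizationSumDecay.snuffit`∕`snuffit_printed`, entering here as the hypothesis `hf`);
item 1 of LEMMA 3.15 (the local terms `Y ⊂ Λ_{k+1}`, = part I); of LEMMA 3.17 `third`: (snoopy) and the analyticity of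
`B_{k,𝚷}(X)`, the decoupling expansion L5212–5253 and its Cauchy bounds (the summand shape of `tSum` is the INPUT, as printed
at L5271–5279), the multiscale `𝛀′`-carrier beyond reading (viii), the separation itself (*"these are necessarily a distance at least
r_{k+1}LM apart"*, §3.5 L2726–2727 — the hypothesis `hfar` of `le_torusTreeLenMod_of_far`) and the smallness `𝒪(1)L³B₀λ_k^β
e^{−r_{k+1}} ≤ λ_k^{n₀}`; of the Summary: the analyticity domains (500) and the measure `dμ*` of (primeprime) (only the
polymer-function bookkeeping is typed); anything of B1–B16 (TEMPLATE.md §4.2 row «D2 §3.13»: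
the Bałaban-side loci B14 §2–§3 ∕ B16 §1 untouched, grade T unchanged).  NOT summit progress; NOT a statement about any
Bałaban paper; NOT continuum; NOT Clay.  NEW leaf; imports this lineage's `ActiveBoundaryTerms` (gen 35),
`ResummationOperation` (gen 30; through it `HoleSummability`, `ThreeSortedResummation`), `Reblocking` (gen 11), (from
v1.2) `ConnectedPolymerSums` (LEMMA D.2 on the torus) and (from v1.3) `SeparatedCubesTreeLength` (unit pv12's far-cubes length
bound); no Summits import; no cycle; modifies nothing; no named fact (net debt 0).  Unit `b2b-balaban-template` gen 41 round 1
(journal CLAIM D2-FIRST-TORUS-KERNEL); cell records TEMPLATE.md §4.2 row «D2 §3.13», GAPS C-tmpl41-1.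

**Version.**  v1 (gen 41 round 1, literature-prover-b2b-balaban-template-g41-0, 2026-08-20) = p232905, commit a942f9891920:
Parts 1–7 + the closing example.  v1.1 (gen 41 round 2, same seat, 2026-08-20): APPEND-ONLY (every v1 declaration
byte-identical and in order; this header extended): Parts 8–10 — the geometric inputs of LEMMA 3.17 `third`'s summation
(TeX L5281–5310): coarsening of `coverLen` and the extraction inequality, LEMMA 20 of part I for target families, (shonuff);
journal CLAIM D2-THIRD-GEOMETRY-KERNEL; GAPS C-tmpl41-2; = p233433, commit 05accbe1df0d.  v1.2 (gen 41 round 3, same seat,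
2026-08-20): APPEND-ONLY (v1.1 declarations byte-identical and in order; one import added — `ConnectedPolymerSums`; this
header extended): Part 11 — LEMMA 3.17's summation (TeX L5256–5340) assembled on the two tori; journal CLAIM
D2-THIRD-SUM-KERNEL; GAPS C-tmpl41-3; = p234075, commit 4e56e1cd98b7.  v1.3 (gen 41 round 4, same seat, 2026-08-20):
APPEND (v1.2 declarations — statements, proofs, names, order — unchanged; one import added — `SeparatedCubesTreeLength`; this
header extended): Part 12 — LEMMA 3.17's `B̃` terms (L5346–5357) and the tiny factor `d_{LM}(Z, mod Ω^c_{k+1}) ≥ r_{k+1}`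
(L5359–5372); Part 13 — the §3.13 Summary (L5378–5431); plus a LOCATOR DOCFIX: the arXiv-TeX line locators in the docstrings
of Parts 8–11 and in this header were re-measured against the TeX `75c5792fc48eacbc` (the `\label` anchors were right; prose
and display loci past L5236 had drifted by −3 … +40 lines in v1.1∕v1.2, e.g. (shonuff) is L5292–5295 with proof L5296–5310,
the process `Y, Y₁ → Z` L5256–5262, «Collecting our estimates» L5271–5279, the result L5337–5340, the tiny factor L5359–5365)
— docstring text only, the code of the v1.2 region byte-identical after stripping comments; journal CLAIM D2-THIRD-TAIL-KERNEL;
GAPS C-tmpl41-4.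
-/

noncomputable section

open Real Finset
open Literature.MathematicalPhysics.QuantumFieldTheory.Balaban1983to89.TreeLengthTorus
open Literature.MathematicalPhysics.QuantumFieldTheory.Balaban1983to89.B12TreeDecay (kappa₀ K₀ K₀_pos kappa₀_nonneg)
open Literature.MathematicalPhysics.QuantumFieldTheory.Dimock2011to13.Reblocking (doms mem_doms domsAt mem_domsAt
  sum_domsAt_exp_le)
open Literature.MathematicalPhysics.QuantumFieldTheory.Dimock2011to13.ThreeSorted
open Literature.MathematicalPhysics.QuantumFieldTheory.Dimock2011to13.ResummationOperation
open Literature.MathematicalPhysics.QuantumFieldTheory.Dimock2011to13.LocalizedExtraction (Crosses)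
open Literature.MathematicalPhysics.QuantumFieldTheory.Dimock2011to13.ActiveBoundaryTerms

namespace Literature.MathematicalPhysics.QuantumFieldTheory.Dimock2011to13.ActiveBoundaryTermsTorus

variable {d n : ℕ} [NeZero n]

/-! ## Part 1. `Z ↦ Z⁺ = adjoin Θ Z` on polymers, the index set of (city), and (siouZ) -/

/-- `Z⁺ ∈ 𝒟⁰_{k+1}`: adjoining the met wall-components of `Ω^c_{k+1}` to a polymer gives a polymer (non-empty,
torus-face-connected — `ResummationOperation.adjoin_nonempty`, `tFaceConnected_adjoin`). [cite: Dimock2013BalabanII, §3.13 Lemma 3.15 proof (H) (arXiv:1212.5562v2 TeX L4743–4746)] -/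
theorem adjoin_mem_doms {Z : Finset (TPt d n)} (hZ : Z ∈ doms d n) (Θ : Finset (TPt d n)) :
    adjoin Θ Z ∈ doms d n :=
  mem_doms.2 ⟨adjoin_nonempty (mem_doms.1 hZ).1, tFaceConnected_adjoin (mem_doms.1 hZ).2⟩

omit [NeZero n] in
/-- `Z # Λ_{k+1} ⟹ Z⁺ # Λ_{k+1}` (`Z ⊆ Z⁺`). [cite: Dimock2013BalabanII, §3.13 Lemma 3.15 proof (H) (arXiv:1212.5562v2 TeX L4740–4755)] -/
theorem crosses_adjoin {Z Λ : Finset (TPt d n)} (hZ : Crosses Z Λ) (Θ : Finset (TPt d n)) :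
    Crosses (adjoin Θ Z) Λ := by
  refine ⟨?_, fun h => hZ.2 ((subset_adjoin Θ Z).trans h)⟩
  obtain ⟨b, hb⟩ := hZ.1
  exact ⟨b, mem_inter.2 ⟨subset_adjoin Θ Z (mem_inter.1 hb).1, (mem_inter.1 hb).2⟩⟩

/-- **The index set of (city)** — *"Σ_{Y∈𝒟⁰_{k+1}(mod Ω^c_{k+1}), Y#Λ_{k+1}} B^{(E)}_{k,𝚷⁺}(Y)"*: every `Y = Z⁺` with `Z ∈ P ⊆
𝒟⁰_{k+1}`, `Z # Λ_{k+1}` is a polymer, lies in `𝒟⁰_{k+1}(mod Ω^c_{k+1})` (`ResummationOperation.dMod_adjoin`) and crosses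
`Λ_{k+1}`. [cite: Dimock2013BalabanII, §3.13 Lemma 3.15 eq. (city) and proof (H) (arXiv:1212.5562v2 TeX L4458–4466, L4743–4755)] -/
theorem adjoin_image {P : Finset (Finset (TPt d n))} (hP : P ⊆ doms d n) {Λ Θ Y : Finset (TPt d n)}
    (hY : Y ∈ (P.filter (Crosses · Λ)).image (adjoin Θ)) :
    Y ∈ doms d n ∧ DMod Θ Y ∧ Crosses Y Λ := by
  obtain ⟨Z, hZ, rfl⟩ := mem_image.1 hY
  obtain ⟨hZP, hZΛ⟩ := mem_filter.1 hZ
  exact ⟨adjoin_mem_doms (hP hZP) Θ, dMod_adjoin Θ Z, crosses_adjoin hZΛ Θ⟩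

/-- **(siouZ) ON THE TORUS** — *"d_{LM}(Z) ≥ d_{LM}(Z⁺, mod Ω_{k+1}^c) Indeed let τ be a minimal tree joining the cubes in Z
… Then τ is also a tree joining the cubes in Z⁺ ∩ Ω_{k+1} since Z⁺ ∩ Ω_{k+1} = Z ∩ Ω_{k+1} ⊂ Z"*: for every polymer `Z`
and every family of hole cubes `Θ`, `d_{LM}(Z⁺, mod Θ) ≤ d_{LM}(Z)` — `ResummationOperation.torusTreeLenMod_adjoin_le`
with no old holes (`Θ₀ = ∅`, `d(Z, mod ∅) = d(Z)`). [cite: Dimock2013BalabanII, §3.13 Lemma 3.15 proof (H) eq. (siouZ) (arXiv:1212.5562v2 TeX L4756–4762)] -/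
theorem siouZ {Z : Finset (TPt d n)} (hZ : Z ∈ doms d n) (Θ : Finset (TPt d n)) :
    torusTreeLenMod (adjoin Θ Z) Θ ≤ torusTreeLen Z := by
  obtain ⟨hne, hc⟩ := mem_doms.1 hZ
  have h := torusTreeLenMod_adjoin_le (Θ₀ := ∅) (Θ := Θ) hne hc (Finset.empty_subset Θ)
  rwa [torusTreeLenMod_eq_of_disjoint (Finset.disjoint_empty_right Z)] at h

/-! ## Part 2. (drum1): the extraction on the fibres of `Z ↦ Z⁺` -/

omit [NeZero n] in
/-- `B^{(E)}` is the same finite sum as [Dimock2013BalabanIII] App. B's `B′` (`ResummationOperation.Bprime`) over the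
crossing polymers with the adjoining map (reading (vi)). [cite: Dimock2013BalabanII, §3.13 Lemma 3.15 proof (H) (arXiv:1212.5562v2 TeX L4747–4749)] -/
theorem bterm_eq_Bprime (P : Finset (Finset (TPt d n))) (f : Finset (TPt d n) → ℝ) (Λ Θ Y : Finset (TPt d n)) :
    bterm P f Λ (adjoin Θ) Y = Bprime (P.filter (Crosses · Λ)) (adjoin Θ) f Y := rfl

/-- **(drum1) ON THE TORUS** — *"Using this and (snuffit) gives |B^{(E)}_{k,𝚷⁺}(Y)| ≤ 𝒪(1)L³λ_k^{1/4−10ε}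
e^{−(L(κ−κ_0−2)−κ_0)d_{LM}(Y, mod Ω_{k+1}^c)} Σ_{Z⊂Y, Z#Λ_{k+1}} e^{−κ_0 d_{LM}(Z)}"*: if `|f Z| ≤ c·e^{−(a+κ)d_{LM}(Z)}` on the
polymers `Z ∈ P` (`c, a ≥ 0`), then for EVERY family `Y`, `|B^{(E)}(Y)| ≤ c·e^{−a·d_{LM}(Y, mod Θ)}·Σ_{Z∈P, Z#Λ, Z⊆Y}
e^{−κ d_{LM}(Z)}` — on the fibre `Z⁺ = Y` one has `Z ⊆ Y` and, by (siouZ), `e^{−a d(Z)} ≤ e^{−a d(Y, mod Θ)}`.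
[cite: Dimock2013BalabanII, §3.13 Lemma 3.15 proof (H) eq. (drum1) (arXiv:1212.5562v2 TeX L4762–4769)] -/
theorem abs_bterm_adjoin_le {P : Finset (Finset (TPt d n))} (hP : P ⊆ doms d n) (Λ Θ : Finset (TPt d n))
    {f : Finset (TPt d n) → ℝ} {c a κ : ℝ} (hc : 0 ≤ c) (ha : 0 ≤ a)
    (hf : ∀ Z ∈ P, |f Z| ≤ c * exp (-((a + κ) * torusTreeLen Z))) (Y : Finset (TPt d n)) :
    |bterm P f Λ (adjoin Θ) Y| ≤ c * exp (-(a * torusTreeLenMod Y Θ))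
        * ∑ Z ∈ (P.filter (Crosses · Λ)).filter (· ⊆ Y), exp (-(κ * torusTreeLen Z)) := by
  classical
  set F := (P.filter (Crosses · Λ)).filter (fun Z => adjoin Θ Z = Y) with hF
  have hFsub : F ⊆ (P.filter (Crosses · Λ)).filter (· ⊆ Y) := by
    intro Z hZ
    rw [hF, mem_filter] at hZ
    exact mem_filter.2 ⟨hZ.1, hZ.2 ▸ subset_adjoin Θ Z⟩
  have hterm : ∀ Z ∈ F,
      |f Z| ≤ c * exp (-(a * torusTreeLenMod Y Θ)) * exp (-(κ * torusTreeLen Z)) := by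
    intro Z hZ
    rw [hF, mem_filter, mem_filter] at hZ
    obtain ⟨⟨hZP, -⟩, hZY⟩ := hZ
    have hsZ := siouZ (hP hZP) Θ
    rw [hZY] at hsZ
    refine (hf Z hZP).trans ?_
    rw [mul_assoc, ← Real.exp_add]
    refine mul_le_mul_of_nonneg_left (Real.exp_le_exp.2 ?_) hc
    have h1 : a * torusTreeLenMod Y Θ ≤ a * torusTreeLen Z := mul_le_mul_of_nonneg_left hsZ ha
    nlinarith [h1]
  have hbt : bterm P f Λ (adjoin Θ) Y = ∑ Z ∈ F, f Z := rfl
  rw [hbt]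
  calc |∑ Z ∈ F, f Z| ≤ ∑ Z ∈ F, |f Z| := abs_sum_le_sum_abs _ _
    _ ≤ ∑ Z ∈ F, c * exp (-(a * torusTreeLenMod Y Θ)) * exp (-(κ * torusTreeLen Z)) := sum_le_sum hterm
    _ = c * exp (-(a * torusTreeLenMod Y Θ)) * ∑ Z ∈ F, exp (-(κ * torusTreeLen Z)) := by rw [mul_sum]
    _ ≤ c * exp (-(a * torusTreeLenMod Y Θ))
          * ∑ Z ∈ (P.filter (Crosses · Λ)).filter (· ⊆ Y), exp (-(κ * torusTreeLen Z)) :=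
        mul_le_mul_of_nonneg_left
          (sum_le_sum_of_subset_of_nonneg hFsub fun _ _ _ => (exp_pos _).le)
          (mul_nonneg hc (exp_pos _).le)

/-! ## Part 3. (drum2): the one-cube bound by (sudsy) on the torus and the volume step -/

/-- **The one-cube bound** — the inner sum of *"Σ_{□⊂…} Σ_{Z⊃□} e^{−… d_{LM}(Z)}"* ((G) L4731, (drum2) L4771): for `κ ≥
κ₀(4·2^d, 2d)` and polymers `P ⊆ 𝒟⁰_{k+1}`, `Σ_{Z∈P, Z∋□} e^{−κ d_{LM}(Z)} ≤ K₀(4·2^d, 2d)` — the (sudsy)∕(summing0) of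
the torus, `Reblocking.sum_domsAt_exp_le`. [cite: Dimock2013BalabanII, §3.13 Lemma 3.15 proof (G), (H) (arXiv:1212.5562v2 TeX L4728–4735, L4770–4772)] -/
theorem sum_filter_mem_exp_le {P : Finset (Finset (TPt d n))} (hP : P ⊆ doms d n) {κ : ℝ}
    (hκ : kappa₀ (4 * 2 ^ d) (2 * d) ≤ κ) (b : TPt d n) :
    ∑ Z ∈ P.filter (fun Z => b ∈ Z), exp (-(κ * torusTreeLen Z)) ≤ K₀ (4 * 2 ^ d) (2 * d) := by
  classical
  calc ∑ Z ∈ P.filter (fun Z => b ∈ Z), exp (-(κ * torusTreeLen Z))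
      ≤ ∑ Z ∈ domsAt d n b, exp (-(κ * torusTreeLen Z)) := by
        refine sum_le_sum_of_subset_of_nonneg (fun Z hZ => ?_) fun _ _ _ => (exp_pos _).le
        rw [mem_filter] at hZ
        exact mem_domsAt.2 ⟨hZ.2, (mem_doms.1 (hP hZ.1)).2⟩
    _ ≤ K₀ (4 * 2 ^ d) (2 * d) := by
        have h := sum_domsAt_exp_le b hκ
        simpa only [neg_mul] using h

/-- **(drum2), first inequality** — *"But the sum is bounded by 𝒪(1)|Y ∩ Λ_{k+1}|_{LM}"*: `Σ_{Z∈P, Z#Λ, Z⊆Y} e^{−κ d_{LM}(Z)}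
≤ K₀·|Y ∩ Λ|` (`ActiveBoundaryTerms.sum_crosses_subset_le` with the one-cube bound). [cite: Dimock2013BalabanII, §3.13 Lemma 3.15 proof (H) eq. (drum2) (arXiv:1212.5562v2 TeX L4770–4772)] -/
theorem sum_crosses_subset_exp_le {P : Finset (Finset (TPt d n))} (hP : P ⊆ doms d n) (Λ : Finset (TPt d n))
    {κ : ℝ} (hκ : kappa₀ (4 * 2 ^ d) (2 * d) ≤ κ) (Y : Finset (TPt d n)) :
    ∑ Z ∈ (P.filter (Crosses · Λ)).filter (· ⊆ Y), exp (-(κ * torusTreeLen Z))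
      ≤ K₀ (4 * 2 ^ d) (2 * d) * ((Y ∩ Λ).card : ℝ) :=
  sum_crosses_subset_le (P := P) (Λ := Λ) (fun _ => (exp_pos _).le)
    fun b _ => sum_filter_mem_exp_le hP hκ b

/-- **(drum2), the volume step** — *"|Y ∩ Λ_{k+1}|_{LM} ≤ |Y ∩ Ω_{k+1}|_{LM} ≤ 𝒪(1)(d_{LM}(Y ∩ Ω_{k+1}) + 1) = 𝒪(1)(d_{LM}(Y,
mod Ω_{k+1}^c) + 1) ≤ 𝒪(1)e^{d_{LM}(Y, mod Ω_{k+1}^c)}"*: for `Y = Z⁺`, `Z` a polymer, and `Λ_{k+1} ⊆ Ω_{k+1}`: `|Z⁺ ∩ Λ| ≤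
|Z⁺ ∖ Θ| ≤ 2^{d+2}e^{d_{LM}(Z⁺, mod Θ)}` (`ResummationOperation.card_sdiff_le_exp`; reading (iii)).
[cite: Dimock2013BalabanII, §3.13 Lemma 3.15 proof (H) eq. (drum2) (arXiv:1212.5562v2 TeX L4772–4776)] -/
theorem card_inter_le_exp {Z : Finset (TPt d n)} (hZ : Z ∈ doms d n) {Λ Θ : Finset (TPt d n)}
    (hΛ : Disjoint Λ Θ) :
    ((adjoin Θ Z ∩ Λ).card : ℝ) ≤ 2 ^ (d + 2) * exp (torusTreeLenMod (adjoin Θ Z) Θ) := by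
  obtain ⟨hne, hc⟩ := mem_doms.1 hZ
  have hYne : (adjoin Θ Z).Nonempty := adjoin_nonempty hne
  have hYc : TFaceConnected (adjoin Θ Z) := tFaceConnected_adjoin hc
  have hcov : ∃ T, TCover (adjoin Θ Z) (adjoin Θ Z \ Θ) T :=
    exists_tCover_of_dom hYne hYc (Finset.Subset.refl _) Finset.sdiff_subset
  have h1 : ((adjoin Θ Z ∩ Λ).card : ℝ) ≤ ((adjoin Θ Z \ Θ).card : ℝ) := by
    exact_mod_cast card_le_card fun b hb =>
      mem_sdiff.2 ⟨(mem_inter.1 hb).1, fun hbΘ => disjoint_left.1 hΛ (mem_inter.1 hb).2 hbΘ⟩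
  exact h1.trans (card_sdiff_le_exp hcov)

/-! ## Part 4. (boundary) assembled -/

/-- **(drum1) + (drum2) ASSEMBLED ON THE TORUS** — *"The coefficient of d_{LM}(Y ∩ Ω_{k+1}) is then L(κ−κ_0−2)−κ_0−1"*:
for polymers `P ⊆ 𝒟⁰_{k+1}`, `Λ_{k+1} ⊆ Ω_{k+1}` (`Disjoint Λ Θ`), `|f Z| ≤ c·e^{−(a+κ)d_{LM}(Z)}` on `P` with `c, a ≥ 0`, `κ ≥
κ₀(4·2^d, 2d)`: for EVERY family `Y`, `|B^{(E)}(Y)| ≤ c·K₀·2^{d+2}·e^{−(a−1)·d_{LM}(Y, mod Θ)}` (empty fibres of `Z ↦ Z⁺`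
give `B^{(E)}(Y) = 0`). [cite: Dimock2013BalabanII, §3.13 Lemma 3.15 proof (H) eqs. (drum1)–(drum2) (arXiv:1212.5562v2 TeX L4762–4777)] -/
theorem boundary {P : Finset (Finset (TPt d n))} (hP : P ⊆ doms d n) {Λ Θ : Finset (TPt d n)}
    (hΛ : Disjoint Λ Θ) {f : Finset (TPt d n) → ℝ} {c a κ : ℝ} (hc : 0 ≤ c) (ha : 0 ≤ a)
    (hκ : kappa₀ (4 * 2 ^ d) (2 * d) ≤ κ) (hf : ∀ Z ∈ P, |f Z| ≤ c * exp (-((a + κ) * torusTreeLen Z)))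
    (Y : Finset (TPt d n)) :
    |bterm P f Λ (adjoin Θ) Y|
      ≤ c * K₀ (4 * 2 ^ d) (2 * d) * 2 ^ (d + 2) * exp (-((a - 1) * torusTreeLenMod Y Θ)) := by
  classical
  have hK : 0 ≤ K₀ (4 * 2 ^ d) (2 * d) := (K₀_pos _ _).le
  by_cases hfib : ∃ Z ∈ P.filter (Crosses · Λ), adjoin Θ Z = Y
  · obtain ⟨Z₀, hZ₀, hY⟩ := hfib
    have hZ₀P : Z₀ ∈ P := (mem_filter.1 hZ₀).1
    have h1 := abs_bterm_adjoin_le hP Λ Θ hc ha hf Y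
    have h2 := sum_crosses_subset_exp_le hP Λ hκ Y
    have h3 : ((Y ∩ Λ).card : ℝ) ≤ 2 ^ (d + 2) * exp (torusTreeLenMod Y Θ) := by
      rw [← hY]; exact card_inter_le_exp (hP hZ₀P) hΛ
    set t := torusTreeLenMod Y Θ with ht
    have hce : 0 ≤ c * exp (-(a * t)) := mul_nonneg hc (exp_pos _).le
    have hexp : exp (-(a * t)) * exp t = exp (-((a - 1) * t)) := by
      rw [← Real.exp_add]; congr 1; ring
    calc |bterm P f Λ (adjoin Θ) Y|
        ≤ c * exp (-(a * t)) * (K₀ (4 * 2 ^ d) (2 * d) * ((Y ∩ Λ).card : ℝ)) :=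
          h1.trans (mul_le_mul_of_nonneg_left h2 hce)
      _ ≤ c * exp (-(a * t)) * (K₀ (4 * 2 ^ d) (2 * d) * (2 ^ (d + 2) * exp t)) :=
          mul_le_mul_of_nonneg_left (mul_le_mul_of_nonneg_left h3 hK) hce
      _ = c * K₀ (4 * 2 ^ d) (2 * d) * 2 ^ (d + 2) * (exp (-(a * t)) * exp t) := by ring
      _ = c * K₀ (4 * 2 ^ d) (2 * d) * 2 ^ (d + 2) * exp (-((a - 1) * t)) := by rw [hexp]
  · have h0 : bterm P f Λ (adjoin Θ) Y = 0 := by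
      unfold bterm
      exact sum_eq_zero fun Z hZ => absurd ⟨Z, (mem_filter.1 hZ).1, (mem_filter.1 hZ).2⟩ hfib
    rw [h0, abs_zero]
    exact mul_nonneg (mul_nonneg (mul_nonneg hc hK) (by positivity)) (exp_pos _).le

/-- **(boundary) WITH THE PRINTED RATE** — *"|B^{(E)}_{k,𝚷⁺}(Y)| ≤ 𝒪(1)L³λ_k^{1/4−10ε}e^{−L(κ−2κ_0−3)d_{LM}(Y, mod Ω^c_{k+1})}"*
(L4477–4480), *"The coefficient … is then L(κ−κ_0−2)−κ_0−1 ≥ L(κ−2κ_0−3) and we have the result"* (L4777): from the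
(snuffit) shape `|f Z| ≤ c·e^{−L(κ−κ₀−2)d_{LM}(Z)}` (`LocalizationSumDecay.snuffit_printed`, `κ₀ = κ₀(4·2^d, 2d)`) with `L ≥ 1`
and `κ₀ ≤ L(κ−κ₀−2)`: for every `Y`, `|B^{(E)}(Y)| ≤ c·K₀·2^{d+2}·e^{−L(κ−2κ₀−3)·d_{LM}(Y, mod Θ)}` (the slack being
`(L−1)(κ₀+1) ≥ 0`). [cite: Dimock2013BalabanII, §3.13 Lemma 3.15 eq. (boundary) with proof (H) (arXiv:1212.5562v2 TeX L4474–4481, L4762–4777)] -/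
theorem boundary_printed {P : Finset (Finset (TPt d n))} (hP : P ⊆ doms d n) {Λ Θ : Finset (TPt d n)}
    (hΛ : Disjoint Λ Θ) {f : Finset (TPt d n) → ℝ} {c κ L : ℝ} (hc : 0 ≤ c) (hL : 1 ≤ L)
    (hrate : kappa₀ (4 * 2 ^ d) (2 * d) ≤ L * (κ - kappa₀ (4 * 2 ^ d) (2 * d) - 2))
    (hf : ∀ Z ∈ P, |f Z| ≤ c * exp (-(L * (κ - kappa₀ (4 * 2 ^ d) (2 * d) - 2)) * torusTreeLen Z))
    (Y : Finset (TPt d n)) :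
    |bterm P f Λ (adjoin Θ) Y| ≤ c * K₀ (4 * 2 ^ d) (2 * d) * 2 ^ (d + 2)
        * exp (-(L * (κ - 2 * kappa₀ (4 * 2 ^ d) (2 * d) - 3)) * torusTreeLenMod Y Θ) := by
  set κ₀ := kappa₀ (4 * 2 ^ d) (2 * d) with hκ₀
  have hκ₀0 : 0 ≤ κ₀ := kappa₀_nonneg (by positivity) _
  set a := L * (κ - κ₀ - 2) - κ₀ with ha
  have ha0 : 0 ≤ a := by rw [ha]; linarith
  have hf' : ∀ Z ∈ P, |f Z| ≤ c * exp (-((a + κ₀) * torusTreeLen Z)) := by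
    intro Z hZ
    have h := hf Z hZ
    have heq : -(L * (κ - κ₀ - 2)) * torusTreeLen Z = -((a + κ₀) * torusTreeLen Z) := by rw [ha]; ring
    rwa [heq] at h
  have h := boundary hP hΛ hc ha0 le_rfl hf' Y
  refine h.trans (mul_le_mul_of_nonneg_left (Real.exp_le_exp.2 ?_) ?_)
  · have ht : 0 ≤ torusTreeLenMod Y Θ := torusTreeLenMod_nonneg Y Θ
    have hslack : L * (κ - 2 * κ₀ - 3) ≤ a - 1 := by
      rw [ha]; nlinarith [mul_nonneg (sub_nonneg.2 hL) (add_nonneg hκ₀0 zero_le_one)]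
    rw [neg_mul]
    nlinarith [mul_le_mul_of_nonneg_right hslack ht]
  · exact mul_nonneg (mul_nonneg hc (K₀_pos _ _).le) (by positivity)

/-! ## Part 5. (G): the `B̃` terms — polymers outside `Λ_{k+1}`, each meeting `Λ̄_k` -/

/-- **(G) ON THE TORUS** — *"Terms in (foreign) with Z ⊂ Λ^c_{k+1} are the B̃_{k+1,𝚷⁺} terms in (city). These are estimated
by … Σ_{Z: Z⊂Λ^c_{k+1}, Z∩Λ_k≠∅} e^{−L(κ−κ_0−2)d_{LM}(Z)} ≤ … Σ_{□⊂Λ̄_k−Λ_{k+1}} Σ_{Z⊃□} e^{−L(κ−κ_0−2)d_{LM}(Z)} ≤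
𝒪(1)L³λ_k^{1/4−10ε}|Λ̄_k − Λ_{k+1}|_{LM}"*: for polymers `Z ∈ P ⊆ 𝒟⁰_{k+1}` each MEETING a family `S` (print: `Z ∩ Λ_k ≠ ∅`,
`S = Λ̄_k` the `LM`-cubes meeting `Λ_k`), `|f Z| ≤ c·e^{−κ d_{LM}(Z)}` with `κ ≥ κ₀(4·2^d, 2d)`: `|Σ_{Z∈P, Z∩Λ=∅} f Z| ≤
c·K₀·|S ∖ Λ|` — a `Z` disjoint from `Λ` meets `S` in a cube of `S ∖ Λ`; union bound; one-cube bound (Part 3).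
[cite: Dimock2013BalabanII, §3.13 Lemma 3.15 proof (G) (arXiv:1212.5562v2 TeX L4724–4736)] -/
theorem abs_sum_disjoint_le_meets {P : Finset (Finset (TPt d n))} (hP : P ⊆ doms d n) (Λ S : Finset (TPt d n))
    (hPS : ∀ Z ∈ P, (Z ∩ S).Nonempty) {f : Finset (TPt d n) → ℝ} {c κ : ℝ} (hc : 0 ≤ c)
    (hκ : kappa₀ (4 * 2 ^ d) (2 * d) ≤ κ) (hf : ∀ Z ∈ P, |f Z| ≤ c * exp (-(κ * torusTreeLen Z))) :
    |∑ Z ∈ P.filter (fun Z => Disjoint Z Λ), f Z| ≤ c * K₀ (4 * 2 ^ d) (2 * d) * ((S \ Λ).card : ℝ) := by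
  classical
  set D := P.filter (fun Z => Disjoint Z Λ) with hD
  have hDP : D ⊆ P := filter_subset _ _
  calc |∑ Z ∈ D, f Z| ≤ ∑ Z ∈ D, |f Z| := abs_sum_le_sum_abs _ _
    _ ≤ ∑ Z ∈ D, c * exp (-(κ * torusTreeLen Z)) := sum_le_sum fun Z hZ => hf Z (hDP hZ)
    _ = c * ∑ Z ∈ D, exp (-(κ * torusTreeLen Z)) := by rw [mul_sum]
    _ ≤ c * ∑ b ∈ S \ Λ, ∑ Z ∈ P.filter (fun Z => b ∈ Z), exp (-(κ * torusTreeLen Z)) := by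
        refine mul_le_mul_of_nonneg_left
          (sum_le_sum_cubes hDP (fun Z hZ => ?_) fun _ => (exp_pos _).le) hc
        obtain ⟨hZP, hZΛ⟩ := mem_filter.1 hZ
        obtain ⟨b, hb⟩ := hPS Z hZP
        rw [mem_inter] at hb
        exact ⟨b, mem_sdiff.2 ⟨hb.2, fun hbΛ => disjoint_left.1 hZΛ hb.1 hbΛ⟩, hb.1⟩
    _ ≤ c * ∑ _b ∈ S \ Λ, K₀ (4 * 2 ^ d) (2 * d) :=
        mul_le_mul_of_nonneg_left (sum_le_sum fun b _ => sum_filter_mem_exp_le hP hκ b) hc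
    _ = c * K₀ (4 * 2 ^ d) (2 * d) * ((S \ Λ).card : ℝ) := by
        rw [sum_const, nsmul_eq_mul]; ring

/-! ## Part 6. (E) and (city) on the torus -/

/-- **(foreign)** — *"The function (δE^+_k)^{(iv)}(Z) vanishes unless Z ∩ Λ^c_{k+1} ≠ ∅, Z ∩ Λ_k ≠ ∅ so we can write our
expression as Σ_{Z∈𝒟⁰_{k+1}, Z∩Λ^c_{k+1}≠∅, Z∩Λ_k≠∅} (δE^+_k)^{(iv)}(Z)"*: a finite sum may be restricted to any family of
indices outside which the summand vanishes (bookkeeping; the vanishing is the analytic input). [cite: Dimock2013BalabanII, §3.13 Lemma 3.15 proof (E) eq. (foreign) (arXiv:1212.5562v2 TeX L4657–4662)] -/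
theorem sum_eq_sum_filter_of_vanishes {C : Type*} (P : Finset (Finset C)) (f : Finset C → ℝ)
    (p : Finset C → Prop) [DecidablePred p] (hvan : ∀ Z ∈ P, ¬ p Z → f Z = 0) :
    ∑ Z ∈ P, f Z = ∑ Z ∈ P.filter p, f Z := by
  rw [sum_filter]
  refine sum_congr rfl fun Z hZ => ?_
  split_ifs with h
  · rfl
  · exact hvan Z hZ h

/-- **(city) ON THE TORUS** with `Z⁺ = adjoin Θ Z`: `Σ_{Z∈P} f Z = Σ_{Z⊆Λ} f Z + Σ_{Y∈(Z↦Z⁺)(P#Λ)} B^{(E)}(Y) + Σ_{Z∩Λ=∅} f Z`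
for polymers `P ⊆ 𝒟⁰_{k+1}` (`ActiveBoundaryTerms.city`; the `Y` range over polymers of `𝒟⁰_{k+1}(mod Θ)` crossing `Λ` by
`adjoin_image`). [cite: Dimock2013BalabanII, §3.13 Lemma 3.15 eq. (city) with proof (G)–(H) (arXiv:1212.5562v2 TeX L4458–4466, L4724–4755)] -/
theorem city_adjoin {P : Finset (Finset (TPt d n))} (hP : P ⊆ doms d n) (f : Finset (TPt d n) → ℝ)
    (Λ Θ : Finset (TPt d n)) :
    ∑ Z ∈ P, f Z = ∑ Z ∈ P.filter (· ⊆ Λ), f Z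
      + ∑ Y ∈ (P.filter (Crosses · Λ)).image (adjoin Θ), bterm P f Λ (adjoin Θ) Y
      + ∑ Z ∈ P.filter (fun Z => Disjoint Z Λ), f Z :=
  city P f Λ (adjoin Θ) fun _ hZ => (mem_doms.1 (hP hZ)).1

/-- On the (foreign) family — every `Z` meets `Λ^c_{k+1}` — the `Z ⊆ Λ_{k+1}` part of (city) is an empty sum (item 1's
local terms come from step (C), not from `(δE^+_k)^{(iv)}`). [cite: Dimock2013BalabanII, §3.13 Lemma 3.15 proof (E), (G), (H) (arXiv:1212.5562v2 TeX L4657–4662, L4724–4741)] -/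
theorem sum_filter_subset_eq_zero {C : Type*} [DecidableEq C] (P : Finset (Finset C)) (f : Finset C → ℝ)
    (Λ : Finset C) (hP : ∀ Z ∈ P, ¬ Z ⊆ Λ) : ∑ Z ∈ P.filter (· ⊆ Λ), f Z = 0 :=
  sum_eq_zero fun Z hZ => absurd (mem_filter.1 hZ).2 (hP Z (mem_filter.1 hZ).1)

/-- **(foreign) ⟹ (city)'s last two terms**: on polymers `P ⊆ 𝒟⁰_{k+1}` none of which lies inside `Λ_{k+1}`,
`Σ_{Z∈P} f Z = Σ_{Y} B^{(E)}(Y) + Σ_{Z∩Λ_{k+1}=∅} f Z` — *"Terms in (foreign) with Z ⊂ Λ^c_{k+1} are the B̃_{k+1,𝚷⁺} terms …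
The remaining terms in (foreign) satisfy Z # Λ_{k+1} and yield the active boundary terms"*. [cite: Dimock2013BalabanII, §3.13 Lemma 3.15 proof (G)–(H) (arXiv:1212.5562v2 TeX L4724–4755)] -/
theorem foreign_split {P : Finset (Finset (TPt d n))} (hP : P ⊆ doms d n) (f : Finset (TPt d n) → ℝ)
    {Λ : Finset (TPt d n)} (hPΛ : ∀ Z ∈ P, ¬ Z ⊆ Λ) (Θ : Finset (TPt d n)) :
    ∑ Z ∈ P, f Z = ∑ Y ∈ (P.filter (Crosses · Λ)).image (adjoin Θ), bterm P f Λ (adjoin Θ) Y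
      + ∑ Z ∈ P.filter (fun Z => Disjoint Z Λ), f Z := by
  rw [city_adjoin hP f Λ Θ, sum_filter_subset_eq_zero P f Λ hPΛ, zero_add]

/-! ## Part 7. LEMMA 3.15's steps (E), (G), (H) in one statement -/

/-- **LEMMA 3.15 (`first`), STEPS (E)(G)(H) ON THE TORUS, IN ONE STATEMENT.**  On the torus of `LM`-cubes, let `Θ` be the
cubes of `Ω^c_{k+1}`, `Λ` those of `Λ_{k+1} ⊆ Ω_{k+1}`, `S` any family (print: `Λ̄_k`), `P ⊆ 𝒟⁰_{k+1}` polymers each meeting `S`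
and none inside `Λ_{k+1}` (the (foreign) family), and `f` (print: `(δE^+_k)^{(iv)}`) with the (snuffit) shape `|f Z| ≤
c·e^{−L(κ−κ₀−2)d_{LM}(Z)}`, `c ≥ 0`, `L ≥ 1`, `κ₀ ≤ L(κ−κ₀−2)` (`κ₀ = κ₀(4·2^d, 2d)`).  Then with `Z⁺ = adjoin Θ Z` and
`B^{(E)}(Y) = Σ_{Z∈P, Z#Λ, Z⁺=Y} f Z`: (1) `Σ_{Z∈P} f Z = Σ_{Y∈(Z↦Z⁺)(P#Λ)} B^{(E)}(Y) + Σ_{Z∈P, Z⊂Λ^c} f Z` ((city)'s boundary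
and `B̃` parts); (2) every such `Y` is a polymer of `𝒟⁰_{k+1}(mod Ω^c_{k+1})` crossing `Λ_{k+1}`; (3) **(boundary)**
`|B^{(E)}(Y)| ≤ c·K₀·2^{d+2}·e^{−L(κ−2κ₀−3)d_{LM}(Y, mod Ω^c_{k+1})}` for every `Y`; (4) **(G)** `|Σ_{Z∈P, Z⊂Λ^c} f Z| ≤ c·K₀·|S ∖
Λ|` (*"bounded by C|Λ_k − Λ_{k+1}|"*). [cite: Dimock2013BalabanII, §3.13 Lemma 3.15 eqs. (city), (boundary) with proof (E), (G), (H) (arXiv:1212.5562v2 TeX L4456–4481, L4651–4662, L4724–4777)] -/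
theorem first_EGH {P : Finset (Finset (TPt d n))} (hP : P ⊆ doms d n) {Λ Θ : Finset (TPt d n)}
    (hΛ : Disjoint Λ Θ) (S : Finset (TPt d n)) (hPS : ∀ Z ∈ P, (Z ∩ S).Nonempty)
    (hPΛ : ∀ Z ∈ P, ¬ Z ⊆ Λ) {f : Finset (TPt d n) → ℝ} {c κ L : ℝ} (hc : 0 ≤ c) (hL : 1 ≤ L)
    (hrate : kappa₀ (4 * 2 ^ d) (2 * d) ≤ L * (κ - kappa₀ (4 * 2 ^ d) (2 * d) - 2))
    (hf : ∀ Z ∈ P, |f Z| ≤ c * exp (-(L * (κ - kappa₀ (4 * 2 ^ d) (2 * d) - 2)) * torusTreeLen Z)) :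
    (∑ Z ∈ P, f Z = ∑ Y ∈ (P.filter (Crosses · Λ)).image (adjoin Θ), bterm P f Λ (adjoin Θ) Y
        + ∑ Z ∈ P.filter (fun Z => Disjoint Z Λ), f Z)
    ∧ (∀ Y ∈ (P.filter (Crosses · Λ)).image (adjoin Θ), Y ∈ doms d n ∧ DMod Θ Y ∧ Crosses Y Λ)
    ∧ (∀ Y, |bterm P f Λ (adjoin Θ) Y| ≤ c * K₀ (4 * 2 ^ d) (2 * d) * 2 ^ (d + 2)
        * exp (-(L * (κ - 2 * kappa₀ (4 * 2 ^ d) (2 * d) - 3)) * torusTreeLenMod Y Θ))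
    ∧ |∑ Z ∈ P.filter (fun Z => Disjoint Z Λ), f Z| ≤ c * K₀ (4 * 2 ^ d) (2 * d) * ((S \ Λ).card : ℝ) := by
  refine ⟨foreign_split hP f hPΛ Θ, fun Y hY => adjoin_image hP hY,
    fun Y => boundary_printed hP hΛ hc hL hrate hf Y, ?_⟩
  have hκ : kappa₀ (4 * 2 ^ d) (2 * d) ≤ L * (κ - kappa₀ (4 * 2 ^ d) (2 * d) - 2) := hrate
  have hf' : ∀ Z ∈ P, |f Z| ≤ c * exp (-(L * (κ - kappa₀ (4 * 2 ^ d) (2 * d) - 2) * torusTreeLen Z)) := by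
    intro Z hZ; have h := hf Z hZ; rwa [neg_mul] at h
  exact abs_sum_disjoint_le_meets hP Λ S hPS hc hκ hf'

end Literature.MathematicalPhysics.QuantumFieldTheory.Dimock2011to13.ActiveBoundaryTermsTorus

/-! ## Non-vacuity: the hypotheses of `first_EGH` are jointly inhabited on every torus -/

open Real Finset
open Literature.MathematicalPhysics.QuantumFieldTheory.Balaban1983to89.TreeLengthTorus
open Literature.MathematicalPhysics.QuantumFieldTheory.Balaban1983to89.B12TreeDecay (kappa₀ K₀)
open Literature.MathematicalPhysics.QuantumFieldTheory.Dimock2011to13.Reblocking (doms mem_doms)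
open Literature.MathematicalPhysics.QuantumFieldTheory.Dimock2011to13.LocalizedExtraction (Crosses)
open Literature.MathematicalPhysics.QuantumFieldTheory.Dimock2011to13.ActiveBoundaryTermsTorus in
/-- Non-vacuity [folklore]: with no holes (`Θ = ∅`), `Λ_{k+1} = ∅`, `S` = all cubes, `P` = all polymers, the (snuffit)
majorant itself as `f` (`c = 1`), `L = 1` and `κ = 2κ₀ + 2`, every hypothesis of `first_EGH` holds. -/
example {d n : ℕ} [NeZero n] :
    let κ₀ := kappa₀ (4 * 2 ^ d) (2 * d)
    let f : Finset (TPt d n) → ℝ := fun Z => exp (-(1 * (2 * κ₀ + 2 - κ₀ - 2)) * torusTreeLen Z)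
    (∀ Z ∈ doms d n, (Z ∩ (univ : Finset (TPt d n))).Nonempty) ∧ (∀ Z ∈ doms d n, ¬ Z ⊆ (∅ : Finset (TPt d n)))
    ∧ Disjoint (∅ : Finset (TPt d n)) (∅ : Finset (TPt d n)) ∧ (0 : ℝ) ≤ 1 ∧ (1 : ℝ) ≤ 1
    ∧ κ₀ ≤ 1 * (2 * κ₀ + 2 - κ₀ - 2)
    ∧ (∀ Z ∈ doms d n, |f Z| ≤ 1 * exp (-(1 * (2 * κ₀ + 2 - κ₀ - 2)) * torusTreeLen Z)) := by
  intro κ₀ f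
  refine ⟨fun Z hZ => ?_, fun Z hZ h => ?_, disjoint_empty_right _, zero_le_one, le_rfl, le_of_eq (by ring),
    fun Z _ => ?_⟩
  · obtain ⟨b, hb⟩ := (mem_doms.1 hZ).1
    exact ⟨b, mem_inter.2 ⟨hb, mem_univ b⟩⟩
  · exact (mem_doms.1 hZ).1.ne_empty (subset_empty.1 h)
  · rw [one_mul, abs_of_pos (exp_pos _)]

/-! # v1.1 (gen 41 round 2): the geometric inputs of LEMMA 3.17 (`third`) -/

open Literature.MathematicalPhysics.QuantumFieldTheory.Balaban1983to89.B13ScaleTransfer (coarse)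
open Literature.MathematicalPhysics.QuantumFieldTheory.Balaban1983to89.TreeLength
open Literature.MathematicalPhysics.QuantumFieldTheory.Balaban1983to89.TreeLengthTorusGeometry
open Literature.MathematicalPhysics.QuantumFieldTheory.Balaban1983to89.TreeLengthTorusTransfer
open Literature.MathematicalPhysics.QuantumFieldTheory.Dimock2011to13.ThreeSorted
open Literature.MathematicalPhysics.QuantumFieldTheory.Dimock2011to13.ResummationOperation

namespace Literature.MathematicalPhysics.QuantumFieldTheory.Dimock2011to13.ActiveBoundaryTermsTorus

/-! ## Part 8. Coarsening of `coverLen` between the two tori and LEMMA 3.17's extraction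
`d_M(X, mod Ω^c_k) ≥ L·d_{LM}(X̄, mod Ω^c_{k+1})` -/

section Coarsening

variable {d L N' : ℕ} [NeZero L] [NeZero N']

/-- RESCALING A GRAPH WITH A TARGET FAMILY (port of unit pv22's `TreeLengthTorusTransfer.tAdmissible_scale` to
`ThreeSorted.TCover`): the image under `p ↦ p/L` of a graph in `π⁻¹(S)` meeting a lift of every cube of `B` (fine torus,
`L·N′` cubes per direction) is a graph in `π⁻¹(S̄)` meeting a lift of every block of `B̄` (coarse torus), `S̄`, `B̄` the
families of blocks met — *"if τ is a minimal tree on the M-cubes in X ∩ Ω_k … then it is also a tree … on the LM cubes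
in Y ∩ Ω_{k+1}"*. [cite: Dimock2013BalabanII, §3.13 Lemma 3.17 proof (arXiv:1212.5562v2 TeX L5281–5286)] -/
theorem tCover_scale {S B : Finset (TPt d (L * N'))} {T : List (Seg d)} (hT : TCover S B T) :
    TCover (S.image (tcoarse L N')) (B.image (tcoarse L N')) (T.map (scaleSeg (L : ℝ)⁻¹)) := by
  have hL : 0 < L := Nat.pos_of_ne_zero (NeZero.ne L)
  have hcont : Continuous fun z : RPt d => (L : ℝ)⁻¹ • z := continuous_const_smul _
  refine ⟨?_, ?_, ?_⟩
  · rw [carrier_map_scaleSeg]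
    exact hT.connected.image _ hcont.continuousOn
  · rw [carrier_map_scaleSeg]
    rintro _ ⟨p, hp, rfl⟩
    obtain ⟨x, hx, hpx⟩ := mem_liftCubes.1 (hT.subset hp)
    refine mem_liftCubes.2 ⟨coarse L x, ?_, smul_mem_cube_coarse hL hpx⟩
    rw [← tcoarse_proj]
    exact Finset.mem_image_of_mem _ hx
  · intro b hb
    rw [Finset.mem_image] at hb
    obtain ⟨a, ha, rfl⟩ := hb
    obtain ⟨x, hxa, p, hpT, hpx⟩ := hT.meets a ha
    refine ⟨coarse L x, ?_, (L : ℝ)⁻¹ • p, ?_, smul_mem_cube_coarse hL hpx⟩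
    · rw [← tcoarse_proj, hxa]
    · rw [carrier_map_scaleSeg]
      exact Set.mem_image_of_mem _ hpT

/-- EXACT COARSENING FOR TARGET FAMILIES: `L · coverLen S̄ B̄ ≤ coverLen S B` on a non-empty class (projecting and
rescaling never lengthens; port of pv22's `mul_torusTreeLen_image_le`). [cite: Dimock2013BalabanII, §3.13 Lemma 3.17 proof (arXiv:1212.5562v2 TeX L5281–5286)] -/
theorem mul_coverLen_image_le {S B : Finset (TPt d (L * N'))} (hne : ∃ T, TCover S B T) :
    (L : ℝ) * coverLen (S.image (tcoarse L N')) (B.image (tcoarse L N')) ≤ coverLen S B := by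
  have hL : 0 < L := Nat.pos_of_ne_zero (NeZero.ne L)
  have hLr : (0 : ℝ) < L := by exact_mod_cast hL
  refine le_coverLen hne fun T hT => ?_
  have h1 := coverLen_le_len (tCover_scale hT)
  rw [len_map_scaleSeg (inv_nonneg.2 hLr.le)] at h1
  calc (L : ℝ) * coverLen (S.image (tcoarse L N')) (B.image (tcoarse L N')) ≤ (L : ℝ) * ((L : ℝ)⁻¹ * len T) :=
        mul_le_mul_of_nonneg_left h1 hLr.le
    _ = len T := by field_simp

/-- **LEMMA 3.17's EXTRACTION INEQUALITY** — *"To extract a decay factor first note that for X̄ = Y  d_M(X, mod Ω_k^c) ≥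
L d_{LM}(Y, mod Ω_{k+1}^c)  This follows since if τ is a minimal tree on the M-cubes in X ∩ Ω_k with ℓ(τ) = M d_M(X, mod
Ω_k^c), then it is also a tree on the M-cubes in X ∩ Ω_{k+1}, and hence on the LM cubes in Y ∩ Ω_{k+1}. So ℓ(τ) ≥ LM
d_{LM}(X, mod Ω_{k+1}^c)"*: for a polymer `X` of the fine torus, old hole cubes `Θk` (= `Ω_k^c`, `M`-cubes) and new hole
blocks `Θ` (= `Ω_{k+1}^c`, `LM`-cubes) with `Ω_{k+1} ⊆ Ω_k` in the form *every old hole cube lies in a new hole block*,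
`L · d_{LM}(X̄, mod Θ) ≤ d_M(X, mod Θk)`. [cite: Dimock2013BalabanII, §3.13 Lemma 3.17 proof (arXiv:1212.5562v2 TeX L5281–5286)] -/
theorem mul_torusTreeLenMod_image_le {X Θk : Finset (TPt d (L * N'))} (hX : X.Nonempty) (hc : TFaceConnected X)
    {Θ : Finset (TPt d N')} (hΘ : ∀ a ∈ Θk, tcoarse L N' a ∈ Θ) :
    (L : ℝ) * torusTreeLenMod (X.image (tcoarse L N')) Θ ≤ torusTreeLenMod X Θk := by
  have hL : 0 < L := Nat.pos_of_ne_zero (NeZero.ne L)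
  have hLr : (0 : ℝ) < L := by exact_mod_cast hL
  obtain ⟨T, hT⟩ : ∃ T, TCover X (X \ Θk) T :=
    exists_tCover_of_dom hX hc (Finset.Subset.refl X) Finset.sdiff_subset
  have hsub : X.image (tcoarse L N') \ Θ ⊆ (X \ Θk).image (tcoarse L N') := by
    intro b hb
    obtain ⟨hbX, hbΘ⟩ := Finset.mem_sdiff.1 hb
    obtain ⟨a, ha, rfl⟩ := Finset.mem_image.1 hbX
    exact Finset.mem_image.2 ⟨a, Finset.mem_sdiff.2 ⟨ha, fun haΘ => hbΘ (hΘ a haΘ)⟩, rfl⟩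
  rw [torusTreeLenMod_eq_coverLen, torusTreeLenMod_eq_coverLen]
  calc (L : ℝ) * coverLen (X.image (tcoarse L N')) (X.image (tcoarse L N') \ Θ)
      ≤ (L : ℝ) * coverLen (X.image (tcoarse L N')) ((X \ Θk).image (tcoarse L N')) :=
        mul_le_mul_of_nonneg_left
          (coverLen_mono (Finset.Subset.refl _) hsub ⟨_, tCover_scale hT⟩) hLr.le
    _ ≤ coverLen X (X \ Θk) := mul_coverLen_image_le ⟨T, hT⟩

end Coarsening

/-! ## Part 9. Adjoining cubes to a TARGET family: LEMMA 20 of part I for `coverLen` -/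

section Adjoin

variable {d N : ℕ}

/-- ADJOIN STEP FOR A TARGET FAMILY (port of pv22's `tadjoin_step`; *"See lemma 20 in part I for more details"*): a
graph in `π⁻¹(S)` meeting the cubes of `B` extends, at cost `≤ 1`, to one meeting also a cube `c ∈ S` having a common
wall with a met cube `a ∈ B ∩ S` — lift the wall through the met lift of `a`, run one segment inside that lift.
[cite: Dimock2013BalabanII, §3.13 Lemma 3.17 proof eq. (shonuff) (arXiv:1212.5562v2 TeX L5292–5300); Dimock2013, §4.5 Lemma 20 (arXiv:1108.1335v2 TeX L2476–2492)] -/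
theorem tCover_adjoin_step {S B : Finset (TPt d N)} {T : List (Seg d)} (hT : TCover S B T) {a c : TPt d N}
    (ha : a ∈ B) (haS : a ∈ S) (hcS : c ∈ S) (hac : TAdj a c) :
    ∃ T', TCover S (insert c B) T' ∧ len T' ≤ len T + 1 := by
  obtain ⟨x, hxa, p, hpT, hpx⟩ := hT.meets a ha
  subst hxa
  obtain ⟨y, hyc, hxy⟩ := exists_lift_adj hac
  obtain ⟨q, hqx, hqy, hpq⟩ := exists_wall_point hxy hpx
  refine ⟨(p, q) :: T, ⟨?_, ?_, ?_⟩, ?_⟩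
  · rw [carrier_cons]
    exact IsConnected.union ⟨p, left_mem_segment ℝ p q, hpT⟩
      ((convex_segment p q).isConnected ⟨p, left_mem_segment ℝ p q⟩) hT.connected
  · rw [carrier_cons, Set.union_subset_iff]
    exact ⟨((convex_cube x).segment_subset hpx hqx).trans (cube_subset_liftCubes haS), hT.subset⟩
  · intro b hb
    rcases Finset.mem_insert.1 hb with rfl | hb
    · exact ⟨y, hyc, q, Set.mem_union_left _ (right_mem_segment ℝ p q), hqy⟩
    · obtain ⟨z, hzb, r, hr, hrz⟩ := hT.meets b hb
      exact ⟨z, hzb, r, Set.mem_union_right _ hr, hrz⟩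
  · rw [len_cons]
    change dist p q + len T ≤ len T + 1
    linarith

/-- FRONTIER CUBE FOR A LINKED TARGET — *"Every component (Y−X)_i has a cube □_i adjacent to a cube in □_i′ ⊂ X across a
2-dimensional face"* (part I, LEMMA 20's proof): if `c₀ ∉ B` is linked inside `B′` to a cube `a₀ ∈ B`, some cube of `B′ ∖ B`
has a common wall with a cube of `B` (first exit along the chain; pv22's `exists_tfrontier` without connectedness of `B′`).
[cite: Dimock2013, §4.5 Lemma 20 proof (arXiv:1108.1335v2 TeX L2485–2487)] -/
theorem exists_tfrontier_of_tLinked {B B' : Finset (TPt d N)} {a₀ c₀ : TPt d N} (ha₀ : a₀ ∈ B)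
    (h : TLinked B' a₀ c₀) (hc₀ : c₀ ∉ B) : ∃ a ∈ B, ∃ c ∈ B', c ∉ B ∧ TAdj a c := by
  have key : ∀ z, TLinked B' a₀ z → z ∈ B ∨ ∃ a ∈ B, ∃ c ∈ B', c ∉ B ∧ TAdj a c := by
    intro z hz
    unfold TLinked at hz
    induction hz with
    | refl => exact Or.inl ha₀
    | @tail b c _ hbc ih =>
      rcases ih with hb | hfr
      · obtain ⟨-, hcY, hadj⟩ := hbc
        by_cases hc : c ∈ B
        · exact Or.inl hc
        · exact Or.inr ⟨b, hb, c, hcY, hc, hadj⟩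
      · exact Or.inr hfr
  rcases key c₀ h with h | h
  · exact absurd h hc₀
  · exact h

/-- GREEDY EXTENSION TO A LINKED TARGET (*"Let {τ_α} be trees on the LM cubes on the connected components of Ȳ_1 − (Y ∩
Ω_{k+1}). Then τ joined to the {τ_α} gives a tree τ′"*): a graph in `π⁻¹(S)` meeting `B ⊇ B₀` extends to one meeting `B′
⊇ B`, `B′ ⊆ S`, at cost `≤ |B′ ∖ B|`, provided every cube of `B′` is linked inside `B′` to a cube of `B₀` — one frontier
cube at a time. [cite: Dimock2013BalabanII, §3.13 Lemma 3.17 proof eq. (shonuff) (arXiv:1212.5562v2 TeX L5296–5310)] -/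
theorem exists_tCover_extend {S B₀ B' : Finset (TPt d N)} (hB'S : B' ⊆ S)
    (hlink : ∀ c ∈ B', ∃ a ∈ B₀, TLinked B' a c) :
    ∀ n : ℕ, ∀ (B : Finset (TPt d N)) (T : List (Seg d)), B₀ ⊆ B → B ⊆ B' → (B' \ B).card = n →
      TCover S B T → ∃ T', TCover S B' T' ∧ len T' ≤ len T + n := by
  intro n
  induction n with
  | zero =>
    intro B T _ hBB' hcard hT
    have hBeq : B = B' :=
      Finset.Subset.antisymm hBB' (Finset.sdiff_eq_empty_iff_subset.1 (Finset.card_eq_zero.1 hcard))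
    rw [hBeq] at hT
    exact ⟨T, hT, by simp⟩
  | succ n ih =>
    intro B T hB₀B hBB' hcard hT
    have hne : (B' \ B).Nonempty := by
      rw [← Finset.card_pos, hcard]
      exact Nat.succ_pos n
    obtain ⟨c₀, hc₀⟩ := hne
    rw [Finset.mem_sdiff] at hc₀
    obtain ⟨a₀, ha₀, hlk⟩ := hlink c₀ hc₀.1
    obtain ⟨a, ha, c, hc, hcB, hac⟩ := exists_tfrontier_of_tLinked (hB₀B ha₀) hlk hc₀.2
    obtain ⟨T₁, hT₁, hlen₁⟩ := tCover_adjoin_step hT ha (hB'S (hBB' ha)) (hB'S hc) hac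
    have hsub : insert c B ⊆ B' := Finset.insert_subset hc hBB'
    have hcard' : (B' \ insert c B).card = n := by
      rw [Finset.sdiff_insert, Finset.card_erase_of_mem (Finset.mem_sdiff.2 ⟨hc, hcB⟩), hcard]
      simp
    obtain ⟨T', hT', hlen'⟩ := ih (insert c B) T₁ (hB₀B.trans (Finset.subset_insert c B)) hsub hcard' hT₁
    refine ⟨T', hT', ?_⟩
    push_cast
    linarith

/-- **LEMMA 20 OF PART I FOR TARGET FAMILIES**: if `B ⊆ B′ ⊆ S`, every cube of `B′` is linked inside `B′` to a cube of
`B`, and the class of `(S, B)` is non-empty, then `coverLen S B′ ≤ |B′ ∖ B| + coverLen S B` — the target-family form of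
pv22's `torusTreeLen_le_card_sdiff_add` (*"M d_M(Y) ≤ M|Y−X|_M + M d_M(X)"*). [cite: Dimock2013, §4.5 Lemma 20 (arXiv:1108.1335v2 TeX L2476–2492); Dimock2013BalabanII, §3.13 Lemma 3.17 proof (arXiv:1212.5562v2 TeX L5290–5310)] -/
theorem coverLen_le_card_sdiff_add {S B B' : Finset (TPt d N)} (hBB' : B ⊆ B') (hB'S : B' ⊆ S)
    (hlink : ∀ c ∈ B', ∃ a ∈ B, TLinked B' a c) (hne : ∃ T, TCover S B T) :
    coverLen S B' ≤ ((B' \ B).card : ℝ) + coverLen S B := by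
  refine le_of_forall_pos_le_add fun ε hε => ?_
  obtain ⟨T, hT, hlt⟩ := exists_tCover_len_lt hne hε
  obtain ⟨T', hT', hlen'⟩ :=
    exists_tCover_extend hB'S hlink _ B T (Finset.Subset.refl B) hBB' rfl hT
  linarith [coverLen_le_len hT']

/-- *"Thus we have constructed a tree joining all the blocks of Y"* (part I, LEMMA 20's proof): under the hypotheses of
`coverLen_le_card_sdiff_add` the class of `(S, B′)` is non-empty. [cite: Dimock2013, §4.5 Lemma 20 proof (arXiv:1108.1335v2 TeX L2484–2491)] -/
theorem exists_tCover_of_linked {S B B' : Finset (TPt d N)} (hBB' : B ⊆ B') (hB'S : B' ⊆ S)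
    (hlink : ∀ c ∈ B', ∃ a ∈ B, TLinked B' a c) (hne : ∃ T, TCover S B T) : ∃ T, TCover S B' T := by
  obtain ⟨T, hT⟩ := hne
  obtain ⟨T', hT', -⟩ := exists_tCover_extend hB'S hlink _ B T (Finset.Subset.refl B) hBB' rfl hT
  exact ⟨T', hT'⟩

end Adjoin

/-! ## Part 10. (shonuff): the join for `Y, Y₁ → Z` -/

section Shonuff

variable {d N : ℕ} [NeZero N]

/-- **(shonuff)** — *"LM|Ȳ_1 − (Y ∩ Ω_{k+1})|_{LM} + LM d_{LM}(Y, mod Ω^c_{k+1}) ≥ LM d_{LM}(Z, mod Ω^c_{k+1})  To see this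
let τ be a minimal tree on the LM cubes in Y ∩ Ω_{k+1} … Let {τ_α} be trees on the LM cubes on the connected components
of Ȳ_1 − (Y ∩ Ω_{k+1}). Then τ joined to the {τ_α} gives a tree τ′ … The tree τ′ is constructed to connect the LM cubes in
(Y ∩ Ω_{k+1}) ∪ (Ȳ_1 − (Y ∩ Ω_{k+1})) = (Y ∩ Ω_{k+1}) ∪ Ȳ_1 ⊃ (Y ∪ Ȳ_1) ∩ Ω_{k+1} = Z_0 ∩ Ω_{k+1} = Z ∩ Ω_{k+1}"* — with `Y`
a polymer of `LM`-cubes, `A` (= `Ȳ₁`) a family containing `Y ∖ Θ` (= `Y ∩ Ω_{k+1}`) every cube of which is linked inside `A`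
to a cube of `Y ∖ Θ` (*"each connected component of Y_1 contains at least one connected component of Y"*), `Z₀ = Y ∪ A`,
`Z = Z₀⁺ = adjoin Θ Z₀`: `d_{LM}(Z, mod Θ) ≤ |A ∖ (Y ∖ Θ)| + d_{LM}(Y, mod Θ)`. [cite: Dimock2013BalabanII, §3.13 Lemma 3.17 proof eq. (shonuff) (arXiv:1212.5562v2 TeX L5290–5310)] -/
theorem shonuff {Y A Θ : Finset (TPt d N)} (hY : Y ∈ doms d N) (hAY : Y \ Θ ⊆ A)
    (hlink : ∀ c ∈ A, ∃ a ∈ Y \ Θ, TLinked A a c) :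
    torusTreeLenMod (adjoin Θ (Y ∪ A)) Θ ≤ ((A \ (Y \ Θ)).card : ℝ) + torusTreeLenMod Y Θ := by
  obtain ⟨hYne, hYc⟩ := mem_doms.1 hY
  set Z₀ := Y ∪ A with hZ₀
  have hAZ₀ : A ⊆ Z₀ := Finset.subset_union_right
  have hYZ₀ : Y ⊆ Z₀ := Finset.subset_union_left
  -- the class of (Y, Y ∖ Θ) and of (Z₀, Y ∖ Θ)
  have hneY : ∃ T, TCover Y (Y \ Θ) T :=
    exists_tCover_of_dom hYne hYc (Finset.Subset.refl Y) Finset.sdiff_subset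
  have hneZ₀ : ∃ T, TCover Z₀ (Y \ Θ) T := hneY.imp fun T hT => hT.mono hYZ₀ (Finset.Subset.refl _)
  -- Step 1: LEMMA 20 for the target A ⊇ Y ∖ Θ inside Z₀
  have h1 : coverLen Z₀ A ≤ ((A \ (Y \ Θ)).card : ℝ) + coverLen Z₀ (Y \ Θ) :=
    coverLen_le_card_sdiff_add hAY hAZ₀ hlink hneZ₀
  have hneA : ∃ T, TCover Z₀ A T := exists_tCover_of_linked hAY hAZ₀ hlink hneZ₀
  -- Step 2: the ambient may shrink back to Y
  have h2 : coverLen Z₀ (Y \ Θ) ≤ torusTreeLenMod Y Θ := by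
    rw [torusTreeLenMod_eq_coverLen]
    exact coverLen_mono hYZ₀ (Finset.Subset.refl _) hneY
  -- Step 3: Z ∖ Θ = Z₀ ∖ Θ ⊆ A and Z₀ ⊆ Z
  have hZΘ : adjoin Θ Z₀ \ Θ ⊆ A := by
    rw [adjoin_sdiff]
    intro b hb
    obtain ⟨hbZ, hbΘ⟩ := Finset.mem_sdiff.1 hb
    rcases Finset.mem_union.1 hbZ with hbY | hbA
    · exact hAY (Finset.mem_sdiff.2 ⟨hbY, hbΘ⟩)
    · exact hbA
  have h3 : torusTreeLenMod (adjoin Θ Z₀) Θ ≤ coverLen Z₀ A := by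
    rw [torusTreeLenMod_eq_coverLen]
    exact coverLen_mono (subset_adjoin Θ Z₀) hZΘ hneA
  linarith

end Shonuff

end Literature.MathematicalPhysics.QuantumFieldTheory.Dimock2011to13.ActiveBoundaryTermsTorus

/-! # v1.2 (gen 41 round 3): LEMMA 3.17 (`third`)'s summation ASSEMBLED on the two tori -/

open Literature.MathematicalPhysics.QuantumFieldTheory.Dimock2011to13.Reblocking (bar bar_mem_doms
  card_filter_tcoarse_mem_le)
open Literature.MathematicalPhysics.QuantumFieldTheory.Dimock2011to13.HoleSummability (kappa₁ K₁ K₁_pos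
  sum_exp_torusTreeLenMod_le)
open Literature.MathematicalPhysics.QuantumFieldTheory.Dimock2011to13.ConnectedPolymerSums (TAnchored donut2_torus)

namespace Literature.MathematicalPhysics.QuantumFieldTheory.Dimock2011to13.ActiveBoundaryTermsTorus

/-! ## Part 11. LEMMA 3.17: the process `Y, Y₁ → Z`, the collected sum of (B_{k,𝚷⁺})″(Z) and its bound (L5256–5340) -/

section Third

variable {d L N' : ℕ} [NeZero L] [NeZero N']

/-- THE `Y₁`-INDEX SET — *"Y_1 … may not be connected, but has the property that each connected component of Y_1 contains at
least one connected component of Y"* (L5239–5240), *"Y_1 ⊃ (Y ∩ Ω_{k+1})"* (L5236, L5261): on the `LM`-cubes (reading (viii)),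
the families `Y₁ ⊇ Y ∖ Θ` anchored to `Y ∖ Θ` (`ConnectedPolymerSums.TAnchored`, the primed condition of LEMMA D.2).
[cite: Dimock2013BalabanII, §3.13 Lemma 3.17 proof (arXiv:1212.5562v2 TeX L5236–5240, L5256–5262)] -/
def P1 (Θ Y : Finset (TPt d N')) : Finset (Finset (TPt d N')) := by
  classical exact univ.filter fun Y₁ => TAnchored (Y \ Θ) Y₁

/-- Membership in `P1`. [cite: Dimock2013BalabanII, §3.13 Lemma 3.17 proof (arXiv:1212.5562v2 TeX L5239–5240, L5261)] -/
theorem mem_P1 {Θ Y Y₁ : Finset (TPt d N')} : Y₁ ∈ P1 Θ Y ↔ TAnchored (Y \ Θ) Y₁ := by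
  classical
  unfold P1
  simp

omit [NeZero N'] in
/-- An anchored family is a linked target in the sense of Parts 9–10. [cite: Dimock2013BalabanII, §3.13 Lemma 3.17 proof and App. D Lemma D.2 (arXiv:1212.5562v2 TeX L5239–5240, L6731)] -/
theorem linked_of_tAnchored {B Y₁ : Finset (TPt d N')} (h : TAnchored B Y₁) :
    ∀ c ∈ Y₁, ∃ a ∈ B, TLinked Y₁ a c := fun c hc => by
  obtain ⟨a, ha, hca⟩ := h.2 c hc
  exact ⟨a, ha, tLinked_symm hca⟩

/-- *"Z_0 = Y ∪ Ȳ_1. This is connected and hence an element of 𝒟⁰_{k+1}"* (L5256–5257): for a polymer `Y` and a family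
`A` anchored to `Y ∖ Θ`, `Y ∪ A` is a polymer. [cite: Dimock2013BalabanII, §3.13 Lemma 3.17 proof (arXiv:1212.5562v2 TeX L5256–5257)] -/
theorem union_mem_doms {Y A Θ : Finset (TPt d N')} (hY : Y ∈ doms d N') (hA : TAnchored (Y \ Θ) A) :
    Y ∪ A ∈ doms d N' := by
  obtain ⟨hne, hc⟩ := mem_doms.1 hY
  refine mem_doms.2 ⟨hne.mono Finset.subset_union_left, ?_⟩
  have hYA : Y ⊆ Y ∪ A := Finset.subset_union_left
  have hAY : A ⊆ Y ∪ A := Finset.subset_union_right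
  have hlink : ∀ x ∈ Y ∪ A, ∃ y ∈ Y, TLinked (Y ∪ A) y x := by
    intro x hx
    rcases Finset.mem_union.1 hx with hxY | hxA
    · exact ⟨x, hxY, Relation.ReflTransGen.refl⟩
    · obtain ⟨a, ha, hxa⟩ := hA.2 x hxA
      have h1 : TLinked A a x := tLinked_symm hxa
      exact ⟨a, (Finset.mem_sdiff.1 ha).1, Literature.MathematicalPhysics.QuantumFieldTheory.Balaban1983to89.TreeLengthTorusTransfer.tLinked_mono hAY h1⟩
  intro x hx y hy
  obtain ⟨x', hx', hx'x⟩ := hlink x hx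
  obtain ⟨y', hy', hy'y⟩ := hlink y hy
  have h2 : TLinked (Y ∪ A) x' y' := Literature.MathematicalPhysics.QuantumFieldTheory.Balaban1983to89.TreeLengthTorusTransfer.tLinked_mono hYA (hc x' hx' y' hy')
  exact tLinked_trans (tLinked_trans (tLinked_symm hx'x) h2) hy'y

/-- *"Then let Z = Z_0⁺ … Then Z ∈ 𝒟⁰_{k+1}(mod Ω_{k+1}^c)"* (L5258–5259): `Z = adjoin Θ (Y ∪ A)` is a polymer (and lies in
`𝒟⁰(mod Θ)` by `ResummationOperation.dMod_adjoin`). [cite: Dimock2013BalabanII, §3.13 Lemma 3.17 proof (arXiv:1212.5562v2 TeX L5258–5259)] -/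
theorem adjoin_union_mem_doms {Y A Θ : Finset (TPt d N')} (hY : Y ∈ doms d N') (hA : TAnchored (Y \ Θ) A) :
    adjoin Θ (Y ∪ A) ∈ doms d N' :=
  adjoin_mem_doms (union_mem_doms hY hA) Θ

/-- **THE COLLECTED MAJORANT OF `(B_{k,𝚷⁺})″(Z)`** — *"(B_{k,𝚷⁺})″(Z) = Σ_{Y, Y_1 → Z, Y_1 ⊃ (Y ∩ Ω_{k+1})} (B_{k,𝚷⁺})′(Y,
Y_1)"* (L5260–5262) with *"Collecting our estimates we have |(B_{k,𝚷⁺})″(Z)| ≤ 𝒪(1)B_0λ_k^β Σ_{Y, Y_1 → Z, Y_1 ⊃ Y ∩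
Ω_{k+1}} e^{−(κ_1−1)|Y_1−(Y ∩ Ω_{k+1})|_{𝛀′}} Σ_{X̄ = Y, X ∩ Ω_{k+1} ≠ ∅, X # Λ_k} e^{−κ d_M(X, mod Ω^c_k)}"* (L5271–5279):
the sum over the polymers `Y` of the coarse torus and the anchored `Y₁` with `(Y ∪ Y₁)⁺ = Z`, of `e^{−(κ₁−1)|Y₁ ∖ (Y ∖
Θ)|}` times the sum over the fine polymers `X ∈ 𝒳` with `X̄ = Y` of `e^{−κ d_M(X, mod Θk)}` (`𝒳` carries the print's side
conditions on `X`; the user multiplies by `𝒪(1)B₀λ_k^β`). [cite: Dimock2013BalabanII, §3.13 Lemma 3.17 proof (arXiv:1212.5562v2 TeX L5260–5279)] -/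
def tSum (Θk : Finset (TPt d (L * N'))) (Θ : Finset (TPt d N')) (𝒳 : Finset (Finset (TPt d (L * N'))))
    (κ κ₁ : ℝ) (Z : Finset (TPt d N')) : ℝ :=
  ∑ Y ∈ doms d N', ∑ Y₁ ∈ (P1 Θ Y).filter (fun Y₁ => adjoin Θ (Y ∪ Y₁) = Z),
    exp (-(κ₁ - 1) * ((Y₁ \ (Y \ Θ)).card : ℝ)) *
      ∑ X ∈ 𝒳.filter (fun X => bar L N' X = Y), exp (-κ * torusTreeLenMod X Θk)

/-- **THE EXTRACTION, TERMWISE** (L5281–5310): *"d_M(X, mod Ω_k^c) ≥ L d_{LM}(Y, mod Ω_{k+1}^c) … We also note that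
|Y_1−(Y ∩ Ω_{k+1})|_{𝛀′} ≥ |Ȳ_1 − (Y ∩ Ω_{k+1})|_{LM} and we can take this factor with a coefficient L by borrowing from
the κ_1−1. Now we claim that (shonuff) …"*: for a fine polymer `X` with `X̄ = Y`, `Y₁` anchored to `Y ∖ Θ`, `Z = (Y ∪ Y₁)⁺`,
`0 ≤ κ₀ ≤ κ` and the «M sufficiently large» clause `L(κ−κ₀) ≤ ½κ₁ − 1` (reading (ix): the borrowed coefficient is
`L(κ−κ₀)`, as in step (F) of LEMMA 3.15), `e^{−(κ₁−1)m}·e^{−κ d_M(X, mod Θk)} ≤ e^{−L(κ−κ₀)d_{LM}(Z, mod Θ)}·(e^{−½κ₁ m}·e^{−κ₀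
d_M(X, mod Θk)})`, `m = |Y₁ ∖ (Y ∖ Θ)|` — by Part 8 (`mul_torusTreeLenMod_image_le`) and Part 10 (`shonuff`).
[cite: Dimock2013BalabanII, §3.13 Lemma 3.17 proof eqs. (shonuff) ff. (arXiv:1212.5562v2 TeX L5281–5322)] -/
theorem third_term {κ κ₀ κ₁ : ℝ} (hκ : κ₀ ≤ κ) (hM : (L : ℝ) * (κ - κ₀) ≤ κ₁ / 2 - 1)
    {Θk : Finset (TPt d (L * N'))} {Θ : Finset (TPt d N')} (hΘ : ∀ a ∈ Θk, tcoarse L N' a ∈ Θ)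
    {X : Finset (TPt d (L * N'))} (hX : X ∈ doms d (L * N')) {Y Y₁ : Finset (TPt d N')}
    (hYX : bar L N' X = Y) (hY₁ : TAnchored (Y \ Θ) Y₁) :
    exp (-(κ₁ - 1) * ((Y₁ \ (Y \ Θ)).card : ℝ)) * exp (-κ * torusTreeLenMod X Θk)
      ≤ exp (-((L : ℝ) * (κ - κ₀)) * torusTreeLenMod (adjoin Θ (Y ∪ Y₁)) Θ) *
        (exp (-(κ₁ / 2) * ((Y₁ \ (Y \ Θ)).card : ℝ)) * exp (-κ₀ * torusTreeLenMod X Θk)) := by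
  have hY : Y ∈ doms d N' := hYX ▸ bar_mem_doms hX
  obtain ⟨hXne, hXc⟩ := mem_doms.1 hX
  have h1 : (L : ℝ) * torusTreeLenMod Y Θ ≤ torusTreeLenMod X Θk := by
    have h := mul_torusTreeLenMod_image_le (L := L) (N' := N') hXne hXc (Θ := Θ) hΘ
    have hYX' : X.image (tcoarse L N') = Y := hYX
    rwa [hYX'] at h
  have h2 : torusTreeLenMod (adjoin Θ (Y ∪ Y₁)) Θ ≤ ((Y₁ \ (Y \ Θ)).card : ℝ) + torusTreeLenMod Y Θ :=
    shonuff hY hY₁.1 (linked_of_tAnchored hY₁)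
  have hm : (0 : ℝ) ≤ ((Y₁ \ (Y \ Θ)).card : ℝ) := Nat.cast_nonneg _
  have hdY : 0 ≤ torusTreeLenMod Y Θ := torusTreeLenMod_nonneg _ _
  have hL0 : (0 : ℝ) ≤ L := Nat.cast_nonneg _
  have hkk : 0 ≤ κ - κ₀ := sub_nonneg.2 hκ
  rw [← Real.exp_add, ← Real.exp_add, ← Real.exp_add, Real.exp_le_exp]
  have h3 : (L : ℝ) * (κ - κ₀) * torusTreeLenMod (adjoin Θ (Y ∪ Y₁)) Θ
      ≤ (L : ℝ) * (κ - κ₀) * (((Y₁ \ (Y \ Θ)).card : ℝ) + torusTreeLenMod Y Θ) :=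
    mul_le_mul_of_nonneg_left h2 (mul_nonneg hL0 hkk)
  have h4 : (L : ℝ) * (κ - κ₀) * ((Y₁ \ (Y \ Θ)).card : ℝ) ≤ (κ₁ / 2 - 1) * ((Y₁ \ (Y \ Θ)).card : ℝ) :=
    mul_le_mul_of_nonneg_right hM hm
  have h5 : (κ - κ₀) * ((L : ℝ) * torusTreeLenMod Y Θ) ≤ (κ - κ₀) * torusTreeLenMod X Θk :=
    mul_le_mul_of_nonneg_left h1 hkk
  nlinarith [h3, h4, h5]

/-- **THE `Y₁`-SUM BY LEMMA D.2** — *"The sum over Y_1 is estimated by lemma donut2 by Σ_{Y_1 ⊃ Y ∩ Ω_{k+1}} e^{−κ_1/2|Y_1−(Y ∩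
Ω_{k+1})|_{𝛀′}} ≤ e^{Ce^{−κ_1/4}|Y ∩ Ω_{k+1}|_{LM}}"* (L5323–5326): over any subfamily of the anchored `Y₁`, at rate `½κ₁`,
under the clause `log 2 + 2log(2d+1) ≤ ¼κ₁` (`ConnectedPolymerSums.donut2_torus`, `Δ = 2d`).
[cite: Dimock2013BalabanII, §3.13 Lemma 3.17 proof (arXiv:1212.5562v2 TeX L5323–5327); App. D Lemma D.2 (L6727)] -/
theorem sum_P1_le {κ₁ : ℝ} (hκ₁ : Real.log 2 + 2 * Real.log (2 * (d : ℝ) + 1) ≤ κ₁ / 4) (Θ Y : Finset (TPt d N'))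
    {F : Finset (Finset (TPt d N'))} (hF : F ⊆ P1 Θ Y) :
    ∑ Y₁ ∈ F, exp (-(κ₁ / 2) * ((Y₁ \ (Y \ Θ)).card : ℝ))
      ≤ exp (exp (-(κ₁ / 4)) * ((2 * (d : ℝ) + 1) * ((Y \ Θ).card : ℝ))) := by
  have hκ' : Real.log 2 + 2 * Real.log (2 * (d : ℝ) + 1) ≤ κ₁ / 2 / 2 := by linarith
  have h := donut2_torus hκ' (Y \ Θ) F (fun Y₁ hY₁ => mem_P1.1 (hF hY₁))
  have e : -(κ₁ / 2 / 2) = -(κ₁ / 4) := by ring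
  rw [e] at h
  exact h

/-- **THE CONSTANTS SUPPRESSED** — *"The second step follows by |Y ∩ Ω_{k+1}|_{LM} ≤ |Z ∩ Ω_{k+1}|_{LM} ≤ 𝒪(1)(d_{LM}(Z, mod
Ω^c_{k+1})+1) as in (drum2). The constants are suppressed by taking M and hence κ_1 sufficiently large"* (L5326–5328):
for a polymer `Z` and `B ⊆ Z ∖ Θ`, under the explicit clause `(2d+1)e^{−¼κ₁}2^{d+2} ≤ 1`, `exp(e^{−¼κ₁}(2d+1)|B|) ≤
e^{1/4}e^{d_{LM}(Z, mod Θ)}` (volume `|Z ∖ Θ| ≤ 2^d(4d(Z, mod Θ)+1)`, `ResummationOperation.card_sdiff_le_torusTreeLenMod`).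
[cite: Dimock2013BalabanII, §3.13 Lemma 3.17 proof (arXiv:1212.5562v2 TeX L5323–5328)] -/
theorem donut_factor_mod_le {κ₁ : ℝ} (hsup : (2 * (d : ℝ) + 1) * exp (-(κ₁ / 4)) * 2 ^ (d + 2) ≤ 1)
    {Z Θ : Finset (TPt d N')} (hZ : Z ∈ doms d N') {B : Finset (TPt d N')} (hB : B ⊆ Z \ Θ) :
    exp (exp (-(κ₁ / 4)) * ((2 * (d : ℝ) + 1) * (B.card : ℝ)))
      ≤ exp (1 / 4) * exp (torusTreeLenMod Z Θ) := by
  have hcov : ∃ T, TCover Z (Z \ Θ) T :=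
    exists_tCover_of_dom (mem_doms.1 hZ).1 (mem_doms.1 hZ).2 (Finset.Subset.refl _) Finset.sdiff_subset
  have h1 : (B.card : ℝ) ≤ ((Z \ Θ).card : ℝ) := by exact_mod_cast card_le_card hB
  have h2 := card_sdiff_le_torusTreeLenMod hcov
  set t := torusTreeLenMod Z Θ with ht
  have ht0 : 0 ≤ t := torusTreeLenMod_nonneg _ _
  rw [← Real.exp_add, Real.exp_le_exp]
  set c := exp (-(κ₁ / 4)) * (2 * (d : ℝ) + 1) with hc
  have hc0 : 0 ≤ c := by positivity
  have hc1 : c * 2 ^ (d + 2) ≤ 1 := by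
    calc c * 2 ^ (d + 2) = (2 * (d : ℝ) + 1) * exp (-(κ₁ / 4)) * 2 ^ (d + 2) := by rw [hc]; ring
      _ ≤ 1 := hsup
  have h3 : c * (B.card : ℝ) ≤ c * (2 ^ d * (4 * t + 1)) := mul_le_mul_of_nonneg_left (h1.trans h2) hc0
  have h4 : c * (2 ^ d * (4 * t + 1)) = (c * 2 ^ (d + 2)) * t + (c * 2 ^ (d + 2)) / 4 := by
    rw [pow_add]; ring
  have h5 : (c * 2 ^ (d + 2)) * t ≤ 1 * t := mul_le_mul_of_nonneg_right hc1 ht0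
  calc exp (-(κ₁ / 4)) * ((2 * (d : ℝ) + 1) * (B.card : ℝ)) = c * (B.card : ℝ) := by rw [hc]; ring
    _ ≤ (c * 2 ^ (d + 2)) * t + (c * 2 ^ (d + 2)) / 4 := by rw [← h4]; exact h3
    _ ≤ 1 / 4 + t := by linarith

/-- **THE `X`-SUM BY (snow)** — *"Identifying Σ_{Y⊂Z} Σ_{X̄=Y} as Σ_{X⊂Z} and using (snow) the remaining sum is dominated by
Σ_{X⊂Z, X∩Ω_{k+1}≠∅} e^{−κ_0 d_M(X, mod Ω^c_k)} ≤ 𝒪(1)|Z ∩ Ω_{k+1}|_M = 𝒪(1)L³|Z ∩ Ω_{k+1}|_{LM}"* (L5329–5334): for fine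
polymers `X ∈ 𝒳`, each in `𝒟_k(mod Θk)` and meeting `Ω_{k+1}` (a cube whose block is not in `Θ`), `Ω_{k+1} ⊆ Ω_k`
blockwise, and `κ₀ ≥ κ₁(d)` (the (snow) threshold of `HoleSummability`): `Σ_{X∈𝒳, X̄⊆Z} e^{−κ₀ d_M(X, mod Θk)} ≤ K₁(d)·L^d·|Z ∖
Θ|` (union bound over the `M`-cubes whose block lies in `Z ∖ Θ`; (snow) = `HoleSummability.sum_exp_torusTreeLenMod_le`;
`Reblocking.card_filter_tcoarse_mem_le`). [cite: Dimock2013BalabanII, §3.13 Lemma 3.17 proof (arXiv:1212.5562v2 TeX L5329–5336); §3.3 eq. (snow) (L1700–1705)] -/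
theorem sum_X_le {κ₀ : ℝ} (hκ₀ : kappa₁ d ≤ κ₀) {Θk : Finset (TPt d (L * N'))} {Θ : Finset (TPt d N')}
    (hΘ : ∀ a ∈ Θk, tcoarse L N' a ∈ Θ) (𝒳 : Finset (Finset (TPt d (L * N'))))
    (h𝒳 : ∀ X ∈ 𝒳, X ∈ doms d (L * N') ∧ DMod Θk X ∧ ∃ a ∈ X, tcoarse L N' a ∉ Θ) (Z : Finset (TPt d N')) :
    ∑ X ∈ 𝒳.filter (fun X => bar L N' X ⊆ Z), exp (-κ₀ * torusTreeLenMod X Θk)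
      ≤ K₁ d * ((L : ℝ) ^ d * ((Z \ Θ).card : ℝ)) := by
  classical
  set T := univ.filter (fun a : TPt d (L * N') => tcoarse L N' a ∈ Z \ Θ) with hTdef
  have hT : ∀ X ∈ 𝒳.filter (fun X => bar L N' X ⊆ Z), ∃ b ∈ T, b ∈ X := by
    intro X hX
    obtain ⟨hX𝒳, hXZ⟩ := mem_filter.1 hX
    obtain ⟨-, -, a, haX, haΘ⟩ := h𝒳 X hX𝒳
    exact ⟨a, mem_filter.2 ⟨mem_univ _, mem_sdiff.2 ⟨hXZ (mem_image_of_mem _ haX), haΘ⟩⟩, haX⟩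
  have h1 := sum_le_sum_cubes (P := 𝒳) (filter_subset _ 𝒳) hT
    (g := fun X => exp (-κ₀ * torusTreeLenMod X Θk)) fun _ => (exp_pos _).le
  have h2 : ∀ b ∈ T, ∑ X ∈ 𝒳.filter (fun X => b ∈ X), exp (-κ₀ * torusTreeLenMod X Θk) ≤ K₁ d := by
    intro b hb
    have hbΘ : tcoarse L N' b ∉ Θ := (mem_sdiff.1 (mem_filter.1 hb).2).2
    have hbk : b ∉ Θk := fun h => hbΘ (hΘ b h)
    refine sum_exp_torusTreeLenMod_le Θk hbk _ (fun X hX => ?_) hκ₀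
    obtain ⟨hX𝒳, hbX⟩ := mem_filter.1 hX
    obtain ⟨hXd, hXD, -⟩ := h𝒳 X hX𝒳
    exact ⟨(mem_doms.1 hXd).1, (mem_doms.1 hXd).2, hbX, hXD⟩
  have h3 : (T.card : ℝ) ≤ (L : ℝ) ^ d * ((Z \ Θ).card : ℝ) := by
    exact_mod_cast card_filter_tcoarse_mem_le (L := L) (N' := N') (Z \ Θ)
  calc ∑ X ∈ 𝒳.filter (fun X => bar L N' X ⊆ Z), exp (-κ₀ * torusTreeLenMod X Θk)
      ≤ ∑ b ∈ T, ∑ X ∈ 𝒳.filter (fun X => b ∈ X), exp (-κ₀ * torusTreeLenMod X Θk) := h1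
    _ ≤ ∑ _b ∈ T, K₁ d := sum_le_sum h2
    _ = K₁ d * T.card := by rw [sum_const, nsmul_eq_mul, mul_comm]
    _ ≤ K₁ d * ((L : ℝ) ^ d * ((Z \ Θ).card : ℝ)) := mul_le_mul_of_nonneg_left h3 (K₁_pos d).le

omit [NeZero L] [NeZero N'] in
/-- *"Identifying Σ_{Y⊂Z} Σ_{X̄=Y} as Σ_{X⊂Z}"* (L5329): fibrewise re-indexing of a sum over pairs `(Y, X)` with `X̄ = Y`.
[cite: Dimock2013BalabanII, §3.13 Lemma 3.17 proof (arXiv:1212.5562v2 TeX L5329)] -/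
theorem sum_sum_fibre_eq (S : Finset (Finset (TPt d N'))) (𝒳 : Finset (Finset (TPt d (L * N'))))
    (g : Finset (TPt d (L * N')) → ℝ) :
    ∑ Y ∈ S, ∑ X ∈ 𝒳.filter (fun X => bar L N' X = Y), g X
      = ∑ X ∈ 𝒳.filter (fun X => bar L N' X ∈ S), g X := by
  classical
  rw [← Finset.sum_fiberwise_of_maps_to (s := 𝒳.filter (fun X => bar L N' X ∈ S)) (t := S)
    (g := fun X => bar L N' X) (fun X hX => (mem_filter.1 hX).2)]
  refine sum_congr rfl fun Y hY => sum_congr ?_ fun _ _ => rfl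
  ext X
  simp only [mem_filter]
  constructor
  · rintro ⟨hX, hXY⟩; exact ⟨⟨hX, hXY ▸ hY⟩, hXY⟩
  · rintro ⟨⟨hX, -⟩, hXY⟩; exact ⟨hX, hXY⟩

/-- **LEMMA 3.17's SUMMATION** (L5313–5340) — *"By the above remarks our estimate becomes |(B_{k,𝚷⁺})″(Z)| ≤ 𝒪(1)λ_k^β B_0
e^{−L(κ−κ_0)d_{LM}(Z, mod Ω^c_{k+1})} Σ_{Y,Y_1→Z, Y_1⊃Y∩Ω_{k+1}} e^{−κ_1/2|Y_1−(Y∩Ω_{k+1})|_{𝛀′}} Σ_{X̄=Y, X∩Ω_{k+1}≠∅} e^{−κ_0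
d_M(X, mod Ω^c_k)}  Relax the sum over Y, Y_1 to just Y ⊂ Z, Y_1 ⊃ Y ∩ Ω_{k+1}. The sum over Y_1 is estimated by lemma
donut2 … ≤ 𝒪(1)e^{d_{LM}(Z, mod Ω^c_{k+1})} … the remaining sum is dominated by … 𝒪(1)L³e^{d_{LM}(Z, mod Ω^c_{k+1})}  Thus
we obtain … |(B_{k,𝚷⁺})″(Z)| ≤ 𝒪(1)L³B_0λ_k^β e^{−L(κ−κ_0−2)d_{LM}(Z, mod Ω^c_{k+1})}"*: ON THE TWO TORI (fine `TPt d (L·N′)`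
of `M`-cubes with old holes `Θk`, coarse `TPt d N′` of `LM`-cubes with new holes `Θ`, `Ω_{k+1} ⊆ Ω_k` blockwise, the
`Y₁`-carrier = `LM`-cubes), for fine polymers `X ∈ 𝒳` in `𝒟_k(mod Θk)` meeting `Ω_{k+1}`, `κ₁(d) ≤ κ₀ ≤ κ`, and the three
explicit «M sufficiently large» clauses `L(κ−κ₀) ≤ ½κ₁ − 1`, `log 2 + 2log(2d+1) ≤ ¼κ₁`, `(2d+1)e^{−¼κ₁}2^{d+2} ≤ 1`: for EVERY
`Z`, `tSum Z ≤ e^{1/4}·2^{d+2}·L^d·K₁(d)·e^{−(L(κ−κ₀)−2)·d_{LM}(Z, mod Θ)}` (`𝒪(1)L³` = `e^{1/4}2^{d+2}K₁(d)·L^d`).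
[cite: Dimock2013BalabanII, §3.13 Lemma 3.17 proof (arXiv:1212.5562v2 TeX L5313–5340)] -/
theorem third_sum {κ κ₀ κ₁ : ℝ} (hκ₀ : kappa₁ d ≤ κ₀) (hκ : κ₀ ≤ κ) (hM : (L : ℝ) * (κ - κ₀) ≤ κ₁ / 2 - 1)
    (hκ₁ : Real.log 2 + 2 * Real.log (2 * (d : ℝ) + 1) ≤ κ₁ / 4)
    (hsup : (2 * (d : ℝ) + 1) * exp (-(κ₁ / 4)) * 2 ^ (d + 2) ≤ 1)
    {Θk : Finset (TPt d (L * N'))} {Θ : Finset (TPt d N')} (hΘ : ∀ a ∈ Θk, tcoarse L N' a ∈ Θ)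
    (𝒳 : Finset (Finset (TPt d (L * N'))))
    (h𝒳 : ∀ X ∈ 𝒳, X ∈ doms d (L * N') ∧ DMod Θk X ∧ ∃ a ∈ X, tcoarse L N' a ∉ Θ) (Z : Finset (TPt d N')) :
    tSum Θk Θ 𝒳 κ κ₁ Z ≤ exp (1 / 4) * 2 ^ (d + 2) * (L : ℝ) ^ d * K₁ d *
        exp (-((L : ℝ) * (κ - κ₀) - 2) * torusTreeLenMod Z Θ) := by
  classical
  set dZ := torusTreeLenMod Z Θ with hdZ
  have hdZ0 : 0 ≤ dZ := torusTreeLenMod_nonneg _ _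
  have hK : 0 ≤ K₁ d := (K₁_pos d).le
  -- the pieces of the relaxed sum (opaque abbreviations with their defining equations)
  obtain ⟨A, hA⟩ : ∃ A : Finset (TPt d N') → ℝ,
      ∀ Y, A Y = ∑ Y₁ ∈ P1 Θ Y, exp (-(κ₁ / 2) * ((Y₁ \ (Y \ Θ)).card : ℝ)) := ⟨_, fun _ => rfl⟩
  obtain ⟨Sx, hSx⟩ : ∃ Sx : Finset (TPt d N') → ℝ,
      ∀ Y, Sx Y = ∑ X ∈ 𝒳.filter (fun X => bar L N' X = Y), exp (-κ₀ * torusTreeLenMod X Θk) :=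
    ⟨_, fun _ => rfl⟩
  have hA0 : ∀ Y, 0 ≤ A Y := fun Y => by rw [hA]; exact sum_nonneg fun _ _ => (exp_pos _).le
  have hSx0 : ∀ Y, 0 ≤ Sx Y := fun Y => by rw [hSx]; exact sum_nonneg fun _ _ => (exp_pos _).le
  by_cases hfib : ∃ Y ∈ doms d N', ∃ Y₁ ∈ P1 Θ Y, adjoin Θ (Y ∪ Y₁) = Z
  · obtain ⟨Y₀, hY₀, Y₁₀, hY₁₀, hZ₀⟩ := hfib
    have hZ : Z ∈ doms d N' := hZ₀ ▸ adjoin_union_mem_doms hY₀ (mem_P1.1 hY₁₀)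
    -- Step 1: termwise extraction on each fibre; empty fibres off `Y ⊆ Z`
    have step1 : tSum Θk Θ 𝒳 κ κ₁ Z
        ≤ exp (-((L : ℝ) * (κ - κ₀)) * dZ) * ∑ Y ∈ (doms d N').filter (· ⊆ Z), A Y * Sx Y := by
      unfold tSum
      have hvan : ∀ Y ∈ doms d N', ¬ Y ⊆ Z →
          ∑ Y₁ ∈ (P1 Θ Y).filter (fun Y₁ => adjoin Θ (Y ∪ Y₁) = Z),
            exp (-(κ₁ - 1) * ((Y₁ \ (Y \ Θ)).card : ℝ)) *
              ∑ X ∈ 𝒳.filter (fun X => bar L N' X = Y), exp (-κ * torusTreeLenMod X Θk) = 0 := by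
        intro Y _ hYZ
        refine sum_eq_zero fun Y₁ hY₁ => ?_
        obtain ⟨-, hY₁Z⟩ := mem_filter.1 hY₁
        exact absurd ((subset_union_left.trans (subset_adjoin Θ (Y ∪ Y₁))).trans hY₁Z.le) hYZ
      rw [sum_eq_sum_filter_of_vanishes (doms d N')
        (fun Y => ∑ Y₁ ∈ (P1 Θ Y).filter (fun Y₁ => adjoin Θ (Y ∪ Y₁) = Z),
          exp (-(κ₁ - 1) * ((Y₁ \ (Y \ Θ)).card : ℝ)) *
            ∑ X ∈ 𝒳.filter (fun X => bar L N' X = Y), exp (-κ * torusTreeLenMod X Θk))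
        (· ⊆ Z) hvan, mul_sum]
      refine sum_le_sum fun Y hY => ?_
      obtain ⟨hYd, -⟩ := mem_filter.1 hY
      -- on the fibre of Y
      have hfibre : ∀ Y₁ ∈ (P1 Θ Y).filter (fun Y₁ => adjoin Θ (Y ∪ Y₁) = Z),
          exp (-(κ₁ - 1) * ((Y₁ \ (Y \ Θ)).card : ℝ)) *
              ∑ X ∈ 𝒳.filter (fun X => bar L N' X = Y), exp (-κ * torusTreeLenMod X Θk)
            ≤ exp (-((L : ℝ) * (κ - κ₀)) * dZ) *
              (exp (-(κ₁ / 2) * ((Y₁ \ (Y \ Θ)).card : ℝ)) * Sx Y) := by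
        intro Y₁ hY₁
        obtain ⟨hY₁P, hY₁Z⟩ := mem_filter.1 hY₁
        rw [hSx Y, mul_sum, mul_sum, mul_sum]
        refine sum_le_sum fun X hX => ?_
        obtain ⟨hX𝒳, hXY⟩ := mem_filter.1 hX
        have h := third_term (κ₁ := κ₁) hκ hM hΘ (h𝒳 X hX𝒳).1 hXY (mem_P1.1 hY₁P)
        rw [hY₁Z] at h
        calc exp (-(κ₁ - 1) * ((Y₁ \ (Y \ Θ)).card : ℝ)) * exp (-κ * torusTreeLenMod X Θk)
            ≤ exp (-((L : ℝ) * (κ - κ₀)) * dZ) *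
                (exp (-(κ₁ / 2) * ((Y₁ \ (Y \ Θ)).card : ℝ)) * exp (-κ₀ * torusTreeLenMod X Θk)) := h
          _ = exp (-((L : ℝ) * (κ - κ₀)) * dZ) *
                (exp (-(κ₁ / 2) * ((Y₁ \ (Y \ Θ)).card : ℝ)) * exp (-κ₀ * torusTreeLenMod X Θk)) := rfl
      calc ∑ Y₁ ∈ (P1 Θ Y).filter (fun Y₁ => adjoin Θ (Y ∪ Y₁) = Z),
            exp (-(κ₁ - 1) * ((Y₁ \ (Y \ Θ)).card : ℝ)) *
              ∑ X ∈ 𝒳.filter (fun X => bar L N' X = Y), exp (-κ * torusTreeLenMod X Θk)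
          ≤ ∑ Y₁ ∈ (P1 Θ Y).filter (fun Y₁ => adjoin Θ (Y ∪ Y₁) = Z),
              exp (-((L : ℝ) * (κ - κ₀)) * dZ) * (exp (-(κ₁ / 2) * ((Y₁ \ (Y \ Θ)).card : ℝ)) * Sx Y) :=
            sum_le_sum hfibre
        _ = exp (-((L : ℝ) * (κ - κ₀)) * dZ) *
              ((∑ Y₁ ∈ (P1 Θ Y).filter (fun Y₁ => adjoin Θ (Y ∪ Y₁) = Z),
                exp (-(κ₁ / 2) * ((Y₁ \ (Y \ Θ)).card : ℝ))) * Sx Y) := by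
            rw [sum_mul, mul_sum]
        _ ≤ exp (-((L : ℝ) * (κ - κ₀)) * dZ) * (A Y * Sx Y) := by
            rw [hA Y]
            refine mul_le_mul_of_nonneg_left (mul_le_mul_of_nonneg_right ?_ (hSx0 Y)) (exp_pos _).le
            exact sum_le_sum_of_subset_of_nonneg
              (filter_subset (fun Y₁ => adjoin Θ (Y ∪ Y₁) = Z) (P1 Θ Y)) fun _ _ _ => (exp_pos _).le
    -- Step 2: the Y₁-sum (LEMMA D.2) and the constants, for Y ⊆ Z
    have step2 : ∀ Y ∈ (doms d N').filter (· ⊆ Z), A Y ≤ exp (1 / 4) * exp dZ := by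
      intro Y hY
      obtain ⟨-, hYZ⟩ := mem_filter.1 hY
      have hB : Y \ Θ ⊆ Z \ Θ := sdiff_subset_sdiff hYZ (Finset.Subset.refl Θ)
      rw [hA]
      exact (sum_P1_le hκ₁ Θ Y (Finset.Subset.refl _)).trans (donut_factor_mod_le hsup hZ hB)
    -- Step 3: the X-sum ((snow) + volume)
    have step3 : ∑ Y ∈ (doms d N').filter (· ⊆ Z), Sx Y ≤ K₁ d * (L : ℝ) ^ d * (2 ^ (d + 2) * exp dZ) := by
      have hcov : ∃ T, TCover Z (Z \ Θ) T :=
        exists_tCover_of_dom (mem_doms.1 hZ).1 (mem_doms.1 hZ).2 (Finset.Subset.refl _) Finset.sdiff_subset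
      have hvol := card_sdiff_le_exp hcov
      calc ∑ Y ∈ (doms d N').filter (· ⊆ Z), Sx Y
          = ∑ Y ∈ (doms d N').filter (· ⊆ Z),
              ∑ X ∈ 𝒳.filter (fun X => bar L N' X = Y), exp (-κ₀ * torusTreeLenMod X Θk) :=
            sum_congr rfl fun Y _ => hSx Y
        _ = ∑ X ∈ 𝒳.filter (fun X => bar L N' X ∈ (doms d N').filter (· ⊆ Z)),
              exp (-κ₀ * torusTreeLenMod X Θk) := sum_sum_fibre_eq _ _ _
        _ ≤ ∑ X ∈ 𝒳.filter (fun X => bar L N' X ⊆ Z), exp (-κ₀ * torusTreeLenMod X Θk) := by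
            refine sum_le_sum_of_subset_of_nonneg (fun X hX => ?_) fun _ _ _ => (exp_pos _).le
            obtain ⟨hX𝒳, hXS⟩ := mem_filter.1 hX
            exact mem_filter.2 ⟨hX𝒳, (mem_filter.1 hXS).2⟩
        _ ≤ K₁ d * ((L : ℝ) ^ d * ((Z \ Θ).card : ℝ)) := sum_X_le hκ₀ hΘ 𝒳 h𝒳 Z
        _ ≤ K₁ d * ((L : ℝ) ^ d * (2 ^ (d + 2) * exp dZ)) :=
            mul_le_mul_of_nonneg_left (mul_le_mul_of_nonneg_left hvol (by positivity)) hK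
        _ = K₁ d * (L : ℝ) ^ d * (2 ^ (d + 2) * exp dZ) := by ring
    -- Step 4: assemble
    have step4 : ∑ Y ∈ (doms d N').filter (· ⊆ Z), A Y * Sx Y
        ≤ exp (1 / 4) * exp dZ * (K₁ d * (L : ℝ) ^ d * (2 ^ (d + 2) * exp dZ)) := by
      calc ∑ Y ∈ (doms d N').filter (· ⊆ Z), A Y * Sx Y
          ≤ ∑ Y ∈ (doms d N').filter (· ⊆ Z), exp (1 / 4) * exp dZ * Sx Y :=
            sum_le_sum fun Y hY => mul_le_mul_of_nonneg_right (step2 Y hY) (hSx0 Y)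
        _ = exp (1 / 4) * exp dZ * ∑ Y ∈ (doms d N').filter (· ⊆ Z), Sx Y := by rw [mul_sum]
        _ ≤ exp (1 / 4) * exp dZ * (K₁ d * (L : ℝ) ^ d * (2 ^ (d + 2) * exp dZ)) :=
            mul_le_mul_of_nonneg_left step3 (by positivity)
    have hexp : exp (-((L : ℝ) * (κ - κ₀)) * dZ) * (exp dZ * exp dZ)
        = exp (-((L : ℝ) * (κ - κ₀) - 2) * dZ) := by
      rw [← Real.exp_add, ← Real.exp_add]; congr 1; ring
    calc tSum Θk Θ 𝒳 κ κ₁ Z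
        ≤ exp (-((L : ℝ) * (κ - κ₀)) * dZ) * ∑ Y ∈ (doms d N').filter (· ⊆ Z), A Y * Sx Y := step1
      _ ≤ exp (-((L : ℝ) * (κ - κ₀)) * dZ) *
            (exp (1 / 4) * exp dZ * (K₁ d * (L : ℝ) ^ d * (2 ^ (d + 2) * exp dZ))) :=
          mul_le_mul_of_nonneg_left step4 (exp_pos _).le
      _ = exp (1 / 4) * 2 ^ (d + 2) * (L : ℝ) ^ d * K₁ d *
            (exp (-((L : ℝ) * (κ - κ₀)) * dZ) * (exp dZ * exp dZ)) := by ring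
      _ = exp (1 / 4) * 2 ^ (d + 2) * (L : ℝ) ^ d * K₁ d * exp (-((L : ℝ) * (κ - κ₀) - 2) * dZ) := by
          rw [hexp]
  · -- no process `Y, Y₁ → Z`: the collected sum is empty
    have h0 : tSum Θk Θ 𝒳 κ κ₁ Z = 0 := by
      unfold tSum
      refine sum_eq_zero fun Y hY => sum_eq_zero fun Y₁ hY₁ => ?_
      obtain ⟨hY₁P, hY₁Z⟩ := mem_filter.1 hY₁
      exact absurd ⟨Y, hY, Y₁, hY₁P, hY₁Z⟩ hfib
    rw [h0]
    exact mul_nonneg (mul_nonneg (by positivity) (K₁_pos d).le) (exp_pos _).le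

/-- **LEMMA 3.17's SUMMATION WITH THE PRINTED RATE** — *"|(B_{k,𝚷⁺})″(Z)| ≤ 𝒪(1)L³B_0λ_k^β e^{−L(κ−κ_0−2)d_{LM}(Z, mod
Ω^c_{k+1})}"* (L5337–5340): for `L ≥ 1`, `L(κ−κ₀) − 2 ≥ L(κ−κ₀−2)`, so `tSum Z ≤ e^{1/4}·2^{d+2}·L^d·K₁(d)·e^{−L(κ−κ₀−2)·d_{LM}(Z,
mod Θ)}`. [cite: Dimock2013BalabanII, §3.13 Lemma 3.17 proof (arXiv:1212.5562v2 TeX L5313–5340)] -/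
theorem third_sum_printed {κ κ₀ κ₁ : ℝ} (hκ₀ : kappa₁ d ≤ κ₀) (hκ : κ₀ ≤ κ) (hL : (1 : ℝ) ≤ L)
    (hM : (L : ℝ) * (κ - κ₀) ≤ κ₁ / 2 - 1) (hκ₁ : Real.log 2 + 2 * Real.log (2 * (d : ℝ) + 1) ≤ κ₁ / 4)
    (hsup : (2 * (d : ℝ) + 1) * exp (-(κ₁ / 4)) * 2 ^ (d + 2) ≤ 1)
    {Θk : Finset (TPt d (L * N'))} {Θ : Finset (TPt d N')} (hΘ : ∀ a ∈ Θk, tcoarse L N' a ∈ Θ)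
    (𝒳 : Finset (Finset (TPt d (L * N'))))
    (h𝒳 : ∀ X ∈ 𝒳, X ∈ doms d (L * N') ∧ DMod Θk X ∧ ∃ a ∈ X, tcoarse L N' a ∉ Θ) (Z : Finset (TPt d N')) :
    tSum Θk Θ 𝒳 κ κ₁ Z ≤ exp (1 / 4) * 2 ^ (d + 2) * (L : ℝ) ^ d * K₁ d *
        exp (-((L : ℝ) * (κ - κ₀ - 2)) * torusTreeLenMod Z Θ) := by
  have h := third_sum hκ₀ hκ hM hκ₁ hsup hΘ 𝒳 h𝒳 Z
  refine h.trans (mul_le_mul_of_nonneg_left (Real.exp_le_exp.2 ?_)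
    (mul_nonneg (by positivity) (K₁_pos d).le))
  have ht : 0 ≤ torusTreeLenMod Z Θ := torusTreeLenMod_nonneg _ _
  have hslack : (L : ℝ) * (κ - κ₀ - 2) ≤ (L : ℝ) * (κ - κ₀) - 2 := by nlinarith
  nlinarith [mul_le_mul_of_nonneg_right hslack ht]

/-- **THE TINY FACTOR** (L5362–5365): *"Then any tree joining the LM cubes in Z ∩ Ω_{k+1} must have length at least
r_{k+1}LM. Hence … d_{LM}(Z, mod Ω^c_{k+1}) ≥ r_{k+1}. We use this to extract a tiny factor e^{−r_{k+1}} leaving say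
e^{−L(κ−κ_0−3)d_M(Z, mod Ω^c_k)}"* — the arithmetic of the extraction: if `d ≥ r` and `a` is the rate, `e^{−a·d} ≤
e^{−r}·e^{−(a−1)·d}`. [cite: Dimock2013BalabanII, §3.13 Lemma 3.17 proof (arXiv:1212.5562v2 TeX L5359–5365)] -/
theorem tiny_factor {a t r : ℝ} (htr : r ≤ t) : exp (-a * t) ≤ exp (-r) * exp (-(a - 1) * t) := by
  rw [← Real.exp_add, Real.exp_le_exp]
  nlinarith

end Third

end Literature.MathematicalPhysics.QuantumFieldTheory.Dimock2011to13.ActiveBoundaryTermsTorus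

/-! ## Non-vacuity of Part 11: the three «M sufficiently large» clauses of `third_sum` are jointly inhabited -/

open Real in
open Literature.MathematicalPhysics.QuantumFieldTheory.Dimock2011to13.HoleSummability (kappa₁) in
/-- Non-vacuity [folklore]: at `d = 3`, `L = 2`, `κ₀ = κ₁(3)`, `κ = κ₀ + 1` and `κ₁ = 80` the clauses `L(κ−κ₀) ≤ ½κ₁ − 1`,
`log 2 + 2log 7 ≤ ¼κ₁`, `7e^{−¼κ₁}2⁵ ≤ 1` of `third_sum` hold. -/
example : (2 : ℝ) * ((kappa₁ 3 + 1) - kappa₁ 3) ≤ (80 : ℝ) / 2 - 1 ∧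
    Real.log 2 + 2 * Real.log (2 * ((3 : ℕ) : ℝ) + 1) ≤ (80 : ℝ) / 4 ∧
    (2 * ((3 : ℕ) : ℝ) + 1) * exp (-((80 : ℝ) / 4)) * 2 ^ (3 + 2) ≤ 1 := by
  have e7 : (2 * ((3 : ℕ) : ℝ) + 1) = 7 := by norm_num
  refine ⟨by norm_num, ?_, ?_⟩
  · have h2 : Real.log 2 ≤ 1 := by
      have := Real.log_le_sub_one_of_pos (by norm_num : (0 : ℝ) < 2); linarith
    have h7 : Real.log 7 ≤ 6 := by
      have := Real.log_le_sub_one_of_pos (by norm_num : (0 : ℝ) < 7); linarith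
    rw [e7]; linarith
  · rw [e7]
    have h5 : (6 : ℝ) ≤ exp 5 := by
      have := Real.add_one_le_exp (5 : ℝ); linarith
    have h54 : (1296 : ℝ) ≤ exp 5 ^ 4 := by
      calc (1296 : ℝ) = 6 ^ 4 := by norm_num
        _ ≤ exp 5 ^ 4 := by gcongr
    have he : exp ((80 : ℝ) / 4) = exp 5 ^ 4 := by
      rw [← Real.exp_nat_mul]; norm_num
    have h20 : exp (-((80 : ℝ) / 4)) ≤ 1 / 224 := by
      rw [Real.exp_neg, he, inv_eq_one_div, one_div_le_one_div (by positivity) (by norm_num)]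
      linarith
    nlinarith [h20, exp_pos (-((80 : ℝ) / 4))]

/-! # v1.3 (gen 41 round 4): LEMMA 3.17's `B̃` terms and the tiny factor `d_{LM}(Z, mod Ω^c_{k+1}) ≥ r_{k+1}` -/

open Literature.MathematicalPhysics.QuantumFieldTheory.Dimock2011to13.SeparatedCubes (le_len_of_meets_far_cubes
  far_lifts_of_not_mem_tball)
open Literature.MathematicalPhysics.QuantumFieldTheory.Dimock2011to13.RegionVolume (tball)

namespace Literature.MathematicalPhysics.QuantumFieldTheory.Dimock2011to13.ActiveBoundaryTermsTorus

/-! ## Part 12. (spitoon2)'s `B̃` terms by (snow), and `d_{LM}(Z, mod Ω^c_{k+1}) ≥ r_{k+1}` for far cubes (L5346–5365) -/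

section ThirdTail

variable {d n : ℕ} [NeZero n]

/-- The one-cube bound MODULO HOLES — the inner sum of *"Σ_{Z ∈ 𝒟⁰_{k+1}(mod Ω^c_{k+1}), Z#Λ_k, Z⊂Λ^c_{k+1}} e^{−L(κ−κ_0−2)d_{LM}(Z,
mod Ω^c_{k+1})} ≤ 𝒪(1)|Λ̄_k − Λ_{k+1}|_{LM}"* (L5346–5355): for polymers `Z ∈ P` in `𝒟⁰(mod Θ)` through a cube `b ∉ Θ` and `κ ≥
κ₁(d)`, `Σ_{Z∈P, Z∋b} e^{−κ d(Z, mod Θ)} ≤ K₁(d)` ((snow) on the coarse torus = `HoleSummability.sum_exp_torusTreeLenMod_le`).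
[cite: Dimock2013BalabanII, §3.13 Lemma 3.17 proof (arXiv:1212.5562v2 TeX L5346–5357); §3.3 eq. (snow) (L1700–1705)] -/
theorem sum_filter_mem_exp_mod_le {P : Finset (Finset (TPt d n))} {Θ : Finset (TPt d n)}
    (hP : ∀ Z ∈ P, Z ∈ doms d n ∧ DMod Θ Z) {κ : ℝ} (hκ : kappa₁ d ≤ κ) {b : TPt d n} (hb : b ∉ Θ) :
    ∑ Z ∈ P.filter (fun Z => b ∈ Z), exp (-κ * torusTreeLenMod Z Θ) ≤ K₁ d := by
  refine sum_exp_torusTreeLenMod_le Θ hb _ (fun Z hZ => ?_) hκ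
  obtain ⟨hZP, hbZ⟩ := mem_filter.1 hZ
  obtain ⟨hZd, hZD⟩ := hP Z hZP
  exact ⟨(mem_doms.1 hZd).1, (mem_doms.1 hZd).2, hbZ, hZD⟩

/-- **LEMMA 3.17's `B̃` TERMS** — *"In the sum (spitoon2) consider terms with Z ⊂ Λ^c_{k+1}. These are B̃_{k+1,𝚷⁺} terms … and
the sum of these terms can be estimated by 𝒪(1)L³B_0λ_k^β times Σ_{Z∈𝒟⁰_{k+1}(mod Ω^c_{k+1}), Z#Λ_k, Z⊂Λ^c_{k+1}}
e^{−L(κ−κ_0−2)d_{LM}(Z, mod Ω^c_{k+1})} ≤ 𝒪(1)|Λ̄_k − Λ_{k+1}|_{LM}"* (L5346–5355): for polymers `Z ∈ P` in `𝒟⁰(mod Θ)` each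
meeting a family `S` disjoint from the holes (print: `Z ∩ Ω_{k+1} ≠ ∅` and `Ω_{k+1} ⊂ Λ̄_k` (§3.5 L2723), so every such `Z`
meets `S` = the `LM`-cubes of `Λ̄_k ∩ Ω_{k+1}`, and `|S ∖ Λ_{k+1}| ≤ |Λ̄_k − Λ_{k+1}|_{LM}`), `|f Z| ≤ c·e^{−κ d(Z, mod Θ)}`, `κ ≥
κ₁(d)`: `|Σ_{Z∈P, Z∩Λ=∅} f Z| ≤ c·K₁(d)·|S ∖ Λ|`.
[cite: Dimock2013BalabanII, §3.13 Lemma 3.17 proof (arXiv:1212.5562v2 TeX L5346–5357)] -/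
theorem abs_sum_disjoint_le_meets_mod {P : Finset (Finset (TPt d n))} {Θ : Finset (TPt d n)}
    (hP : ∀ Z ∈ P, Z ∈ doms d n ∧ DMod Θ Z) (Λ S : Finset (TPt d n)) (hSΘ : Disjoint S Θ)
    (hPS : ∀ Z ∈ P, (Z ∩ S).Nonempty) {f : Finset (TPt d n) → ℝ} {c κ : ℝ} (hc : 0 ≤ c)
    (hκ : kappa₁ d ≤ κ) (hf : ∀ Z ∈ P, |f Z| ≤ c * exp (-κ * torusTreeLenMod Z Θ)) :
    |∑ Z ∈ P.filter (fun Z => Disjoint Z Λ), f Z| ≤ c * K₁ d * ((S \ Λ).card : ℝ) := by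
  classical
  set D := P.filter (fun Z => Disjoint Z Λ) with hD
  have hDP : D ⊆ P := filter_subset _ _
  calc |∑ Z ∈ D, f Z| ≤ ∑ Z ∈ D, |f Z| := abs_sum_le_sum_abs _ _
    _ ≤ ∑ Z ∈ D, c * exp (-κ * torusTreeLenMod Z Θ) := sum_le_sum fun Z hZ => hf Z (hDP hZ)
    _ = c * ∑ Z ∈ D, exp (-κ * torusTreeLenMod Z Θ) := by rw [mul_sum]
    _ ≤ c * ∑ b ∈ S \ Λ, ∑ Z ∈ P.filter (fun Z => b ∈ Z), exp (-κ * torusTreeLenMod Z Θ) := by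
        refine mul_le_mul_of_nonneg_left
          (sum_le_sum_cubes hDP (fun Z hZ => ?_) fun _ => (exp_pos _).le) hc
        obtain ⟨hZP, hZΛ⟩ := mem_filter.1 hZ
        obtain ⟨b, hb⟩ := hPS Z hZP
        rw [mem_inter] at hb
        exact ⟨b, mem_sdiff.2 ⟨hb.2, fun hbΛ => disjoint_left.1 hZΛ hb.1 hbΛ⟩, hb.1⟩
    _ ≤ c * ∑ _b ∈ S \ Λ, K₁ d := by
        refine mul_le_mul_of_nonneg_left (sum_le_sum fun b hb => ?_) hc
        exact sum_filter_mem_exp_mod_le hP hκ (disjoint_left.1 hSΘ (mem_sdiff.1 hb).1)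
    _ = c * K₁ d * ((S \ Λ).card : ℝ) := by
        rw [sum_const, nsmul_eq_mul]; ring

/-- A graph in `π⁻¹(S)` meeting two cubes `a, b` of its target with `b ∉ a^{∼s}` (the cube `a` enlarged by `s` layers,
`RegionVolume.tball`) has length `≥ s` — `SeparatedCubes.le_len_of_meets_far_cubes` ∘ `far_lifts_of_not_mem_tball` for
TARGET families (the graph-level form announced in `SeparatedCubesTreeLength`'s header for the *"mod Ω^c"* distance).
[cite: Dimock2013BalabanII, §3.13 Lemma 3.17 proof (arXiv:1212.5562v2 TeX L5359–5363)] -/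
theorem le_len_of_tCover_far {S B : Finset (TPt d n)} {T : List (Seg d)} (hT : TCover S B T) {a b : TPt d n}
    (ha : a ∈ B) (hb : b ∈ B) {s : ℕ} (hfar : b ∉ tball a s) : (s : ℝ) ≤ len T := by
  obtain ⟨x, hx, hxT⟩ := hT.meets a ha
  obtain ⟨y, hy, hyT⟩ := hT.meets b hb
  exact le_len_of_meets_far_cubes hT.connected.isPreconnected hxT hyT (far_lifts_of_not_mem_tball hfar hx hy)

/-- `coverLen S B ≥ s` when the target contains two cubes `≥ s` layers apart (non-empty class).
[cite: Dimock2013BalabanII, §3.13 Lemma 3.17 proof (arXiv:1212.5562v2 TeX L5359–5363)] -/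
theorem le_coverLen_of_far {S B : Finset (TPt d n)} (hne : ∃ T, TCover S B T) {a b : TPt d n} (ha : a ∈ B)
    (hb : b ∈ B) {s : ℕ} (hfar : b ∉ tball a s) : (s : ℝ) ≤ coverLen S B :=
  le_coverLen hne fun _ hT => le_len_of_tCover_far hT ha hb hfar

/-- **`d_{LM}(Z, mod Ω^c_{k+1}) ≥ r_{k+1}`** — *"Z must have cubes in Ω_{k+1} on the boundary and in Λ_{k+1}, and these are
necessarily a distance at least r_{k+1}LM apart. Then any tree joining the LM cubes in Z ∩ Ω_{k+1} must have length at
least r_{k+1}LM. Hence LMd_{LM}(Z, mod Ω^c_{k+1}) ≥ LMr_{k+1} and therefore d_{LM}(Z, mod Ω^c_{k+1}) ≥ r_{k+1}"*: for a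
polymer `Z` and two cubes `a, b ∈ Z ∖ Θ` with `b ∉ a^{∼r}`, `r ≤ d_{LM}(Z, mod Θ)` (the separation of `Λ_{k+1}` from `∂Ω_{k+1}`
being the user's input, §3.5 L2726–2727). [cite: Dimock2013BalabanII, §3.13 Lemma 3.17 proof (arXiv:1212.5562v2 TeX L5359–5363)] -/
theorem le_torusTreeLenMod_of_far {Z Θ : Finset (TPt d n)} (hZ : Z ∈ doms d n) {a b : TPt d n} (ha : a ∈ Z \ Θ)
    (hb : b ∈ Z \ Θ) {r : ℕ} (hfar : b ∉ tball a r) : (r : ℝ) ≤ torusTreeLenMod Z Θ := by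
  rw [torusTreeLenMod_eq_coverLen]
  exact le_coverLen_of_far
    (exists_tCover_of_dom (mem_doms.1 hZ).1 (mem_doms.1 hZ).2 (Finset.Subset.refl _) Finset.sdiff_subset) ha hb hfar

/-- **THE TINY FACTOR EXTRACTED** — *"We use this to extract a tiny factor e^{−r_{k+1}} leaving say e^{−L(κ−κ_0−3)d_M(Z, mod
Ω^c_k)}. Then for λ_k sufficiently small take 𝒪(1)L³B_0λ_k^βe^{−r_{k+1}} ≤ λ^{n_0}_k"* (L5364–5367): for `L ≥ 1` and `d_{LM}(Z,
mod Θ) ≥ r`, `e^{−L(κ−κ₀−2)d(Z, mod Θ)} ≤ e^{−r}·e^{−L(κ−κ₀−3)d(Z, mod Θ)}` (the smallness `𝒪(1)L³B₀λ_k^βe^{−r_{k+1}} ≤ λ_k^{n₀}` is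
the user's). [cite: Dimock2013BalabanII, §3.13 Lemma 3.17 proof (arXiv:1212.5562v2 TeX L5362–5372)] -/
theorem third_tiny {κ κ₀ L r t : ℝ} (hL : 1 ≤ L) (ht : 0 ≤ t) (hrt : r ≤ t) :
    exp (-(L * (κ - κ₀ - 2)) * t) ≤ exp (-r) * exp (-(L * (κ - κ₀ - 3)) * t) := by
  have h := tiny_factor (a := L * (κ - κ₀ - 2)) hrt
  refine h.trans (mul_le_mul_of_nonneg_left (Real.exp_le_exp.2 ?_) (exp_pos _).le)
  nlinarith [mul_nonneg (sub_nonneg.2 hL) ht]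

end ThirdTail

end Literature.MathematicalPhysics.QuantumFieldTheory.Dimock2011to13.ActiveBoundaryTermsTorus


namespace Literature.MathematicalPhysics.QuantumFieldTheory.Dimock2011to13.ActiveBoundaryTermsTorus

/-! ## Part 13. The §3.13 Summary (L5378–5431): `B^{loc} = B^{(E)} + B^{(R)} + B^{(B)}`, `H_{k,𝚷⁺}(Y)`, one rate `L(κ−3κ₀−3)` -/

section Summary

variable {d n : ℕ}

/-- A decay bound only improves when the rate is lowered (`t ≥ 0`, `c ≥ 0`). [cite: Dimock2013BalabanII, §3.13 Summary, «relaxing the bounds a bit» (arXiv:1212.5562v2 TeX L5397)] -/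
theorem decay_rate_mono {c a a' t : ℝ} (hc : 0 ≤ c) (h : a' ≤ a) (ht : 0 ≤ t) :
    c * exp (-a * t) ≤ c * exp (-a' * t) :=
  mul_le_mul_of_nonneg_left (Real.exp_le_exp.2 (by nlinarith)) hc

/-- **`B^{loc}_{k,𝚷⁺}(Y) = B^{(E)}_{k,𝚷⁺}(Y) + B^{(R)}_{k,𝚷⁺}(Y) + B^{(B)}_{k,𝚷⁺}(Y)`** (L5380–5383) with *"Inserting the results of the
last three lemmas"*: from the three printed rates `L(κ−2κ₀−3)` ((boundary), LEMMA 3.15 L4479), `L(κ−2κ₀−3)` (LEMMA 3.16 L4799)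
and `L(κ−κ₀−3)` (LEMMA 3.17 L5174–5176), for `L, κ₀ ≥ 0` and non-negative prefactors: `|B^{loc}(Y)| ≤ (c_E + c_R +
c_B)·e^{−L(κ−3κ₀−3)·d_{LM}(Y, mod Θ)}` — the Summary's common rate (L5408–5411; cf. `LocalizationSumDecay.summary_rates`).
[cite: Dimock2013BalabanII, §3.13 Summary (arXiv:1212.5562v2 TeX L5378–5411)] -/
theorem abs_Bloc_le {BE BR BB : Finset (TPt d n) → ℝ} {Θ : Finset (TPt d n)} {cE cR cB κ κ₀ L : ℝ}
    (hκ₀ : 0 ≤ κ₀) (hL : 0 ≤ L) (hcE : 0 ≤ cE) (hcR : 0 ≤ cR) (hcB : 0 ≤ cB)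
    (hE : ∀ Y, |BE Y| ≤ cE * exp (-(L * (κ - 2 * κ₀ - 3)) * torusTreeLenMod Y Θ))
    (hR : ∀ Y, |BR Y| ≤ cR * exp (-(L * (κ - 2 * κ₀ - 3)) * torusTreeLenMod Y Θ))
    (hB : ∀ Y, |BB Y| ≤ cB * exp (-(L * (κ - κ₀ - 3)) * torusTreeLenMod Y Θ)) (Y : Finset (TPt d n)) :
    |BE Y + BR Y + BB Y| ≤ (cE + cR + cB) * exp (-(L * (κ - 3 * κ₀ - 3)) * torusTreeLenMod Y Θ) := by
  set t := torusTreeLenMod Y Θ with ht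
  have ht0 : 0 ≤ t := torusTreeLenMod_nonneg _ _
  have h1 : L * (κ - 3 * κ₀ - 3) ≤ L * (κ - 2 * κ₀ - 3) := by nlinarith
  have h2 : L * (κ - 3 * κ₀ - 3) ≤ L * (κ - κ₀ - 3) := by nlinarith
  have eE := (hE Y).trans (decay_rate_mono hcE h1 ht0)
  have eR := (hR Y).trans (decay_rate_mono hcR h1 ht0)
  have eB := (hB Y).trans (decay_rate_mono hcB h2 ht0)
  calc |BE Y + BR Y + BB Y| ≤ |BE Y| + |BR Y| + |BB Y| := by
        refine (abs_add_le _ _).trans ?_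
        have := abs_add_le (BE Y) (BR Y)
        linarith [this]
    _ ≤ (cE + cR + cB) * exp (-(L * (κ - 3 * κ₀ - 3)) * t) := by linarith

/-- **`H_{k,𝚷⁺}(Y) = ((δE^+_k)^{loc}(Y) + R^{loc}_{k,𝚷⁺}(Y))·1_{Y⊂Λ_{k+1}} + B^{loc}_{k,𝚷⁺}(Y)·1_{Y#Λ_{k+1}}`** (L5419–5422): the
single polymer function of the rewritten fluctuation integral `Ξ″ = ∫dμ* exp(Σ_Y H_{k,𝚷⁺}(Y))`. [cite: Dimock2013BalabanII, §3.13 Summary (arXiv:1212.5562v2 TeX L5414–5422)] -/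
def Hloc (E R B : Finset (TPt d n) → ℝ) (Λ : Finset (TPt d n)) (Y : Finset (TPt d n)) : ℝ :=
  (if Y ⊆ Λ then E Y + R Y else 0) + (if Crosses Y Λ then B Y else 0)

/-- The Summary's split `Σ_Y H(Y) = Σ_{Y⊆Λ} (E + R)(Y) + Σ_{Y#Λ} B^{loc}(Y)` over any finite index family (L5386–5394 vs
L5414–5422). [cite: Dimock2013BalabanII, §3.13 Summary (arXiv:1212.5562v2 TeX L5384–5422)] -/
theorem sum_Hloc_eq (P : Finset (Finset (TPt d n))) (E R B : Finset (TPt d n) → ℝ) (Λ : Finset (TPt d n)) :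
    ∑ Y ∈ P, Hloc E R B Λ Y
      = ∑ Y ∈ P.filter (· ⊆ Λ), (E Y + R Y) + ∑ Y ∈ P.filter (Crosses · Λ), B Y := by
  classical
  unfold Hloc
  rw [sum_add_distrib, sum_filter, sum_filter]

/-- **THE SUMMARY'S BOUND ON `H_{k,𝚷⁺}(Y)`** — *"Furthermore if Y ⊂ Λ_{k+1} ⊂ Ω_{k+1} then d_{LM}(Y) = d_{LM}(Y, mod Ω_{k+1}) and so
|H_{k,𝚷⁺}(Y)| ≤ 𝒪(1)L³λ_k^{1/4−10ε}e^{−L(κ−3κ_0−3)d_{LM}(Y, mod Ω^c_{k+1})}"* (L5427–5431): with the Summary's three displayed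
bounds as inputs — `|(δE^+_k)^{loc}(Y)| ≤ c₁e^{−L(κ−3κ₀−3)d_{LM}(Y)}` (L5398–5400), `|R^{loc}(Y)| ≤ c₂e^{−L(κ−3κ₀−3)d_{LM}(Y)}` (L5402–5404),
`|B^{loc}(Y)| ≤ c₃e^{−L(κ−3κ₀−3)d_{LM}(Y, mod Θ)}` (L5408–5411) — and `Λ_{k+1} ⊆ Ω_{k+1}` (`Disjoint Λ Θ`): for every family `Y`,
`|H(Y)| ≤ (c₁ + c₂ + c₃)·e^{−L(κ−3κ₀−3)·d_{LM}(Y, mod Θ)}` (`d_{LM}(Y) = d_{LM}(Y, mod Θ)` for `Y ⊆ Λ` by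
`ThreeSorted.torusTreeLenMod_eq_of_disjoint`). [cite: Dimock2013BalabanII, §3.13 Summary (arXiv:1212.5562v2 TeX L5395–5431)] -/
theorem abs_Hloc_le {E R B : Finset (TPt d n) → ℝ} {Λ Θ : Finset (TPt d n)} (hΛ : Disjoint Λ Θ) {c₁ c₂ c₃ a : ℝ}
    (hc₁ : 0 ≤ c₁) (hc₂ : 0 ≤ c₂) (hc₃ : 0 ≤ c₃)
    (hE : ∀ Y, Y ⊆ Λ → |E Y| ≤ c₁ * exp (-a * torusTreeLen Y))
    (hR : ∀ Y, Y ⊆ Λ → |R Y| ≤ c₂ * exp (-a * torusTreeLen Y))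
    (hB : ∀ Y, Crosses Y Λ → |B Y| ≤ c₃ * exp (-a * torusTreeLenMod Y Θ)) (Y : Finset (TPt d n)) :
    |Hloc E R B Λ Y| ≤ (c₁ + c₂ + c₃) * exp (-a * torusTreeLenMod Y Θ) := by
  have hpos : 0 < exp (-a * torusTreeLenMod Y Θ) := exp_pos _
  unfold Hloc
  by_cases hY : Y ⊆ Λ
  · -- local terms: `Y ⊆ Λ ⊆ Ω`, so `Y` does not cross `Λ` and `d(Y) = d(Y, mod Θ)`
    have hnc : ¬ Crosses Y Λ := fun h => h.2 hY
    have hdis : Disjoint Y Θ := Finset.disjoint_of_subset_left hY hΛ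
    have heq : torusTreeLen Y = torusTreeLenMod Y Θ := (torusTreeLenMod_eq_of_disjoint hdis).symm
    rw [if_pos hY, if_neg hnc, add_zero]
    have e1 := hE Y hY; have e2 := hR Y hY
    rw [heq] at e1 e2
    calc |E Y + R Y| ≤ |E Y| + |R Y| := abs_add_le _ _
      _ ≤ (c₁ + c₂ + c₃) * exp (-a * torusTreeLenMod Y Θ) := by nlinarith
  · rw [if_neg hY, zero_add]
    by_cases hc : Crosses Y Λ
    · rw [if_pos hc]
      have e3 := hB Y hc
      nlinarith
    · rw [if_neg hc, abs_zero]
      positivity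

end Summary

end Literature.MathematicalPhysics.QuantumFieldTheory.Dimock2011to13.ActiveBoundaryTermsTorus

end
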